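import Literature.Topology.FourManifolds.FishtailDiscForms
import HarnessLib

/-!
# The reference disc is embedded

Infrastructure for the explicit fishtail neighbourhood (R. Gompf, *More Cappell–Shaneson spheres
are standard*, Algebr. Geom. Topol. 10 (2010), proof of Thm 2.1 and Lemma 2.2; the named fact
`Literature.Topology.FourManifolds.gompf2010_framedTwist`). Gompf's disc `D` is embedded: the
reference disc map `ζ ↦ tubeD_ref (ζ, 0, 0)` is injective on `‖ζ‖ ≤ R = s₇ + 1`
(`FP.injOn_discRef`). The proof classifies the image points by the invariants
`(latC, yC, baseC)` of `FishtailMTorusInvariants.lean` and the zero-offset forms of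
`FishtailDiscForms.lean`: the `D⁰`-part has `yC = 1` and latitude in `(0, L₂)` (south/annulus)
resp. `[L₂ - 2π, 0)` (north); the upper pieces are physical points `[(e^{i(N-ϑ)}, e^{iY}, e^{iϑ}), S]`
separated by the height `Y`, and within each piece the profile is monotone.

Everything is proved; no named facts.

## References

* R. E. Gompf, *More Cappell–Shaneson spheres are standard*, Algebr. Geom. Topol. 10 (2010)
  1665–1681, proof of Thm 2.1 and Lemma 2.2. [GompfAGT2010]
-/

noncomputable section

open scoped Real Topology ContDiff Manifold
open Set Filter Complex

namespace Literature.Topology.FourManifolds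

local notation "𝔼 " n:arg => EuclideanSpace ℝ (Fin n)

/-! ### The planar path at zero offset -/

section PathZero

variable {ρ : ℝ} (hρ : 0 < ρ)
include hρ

/-- On the flat part: `pathShell ρ (ψ, 0) = (u₀(ψ), 0)`. [folklore] -/
theorem pathShell_zero_flat {ψ : ℝ} (h : ψ < π / 6) : pathShell ρ (ψ, 0) = (flatU ρ ψ, 0) := by
  rw [pathShell_eq_flat hρ (q := (ψ, 0)) h, flatPt]; simp

/-- On the foot part: `pathShell ρ (ψ, 0) = (2ρ, y(ψ))`. [folklore] -/
theorem pathShell_zero_foot {ψ : ℝ} (h : π / 3 < ψ) : pathShell ρ (ψ, 0) = (2 * ρ, footY ρ ψ) := by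
  rw [pathShell_eq_foot hρ (q := (ψ, 0)) h, footPt]; simp

/-- On the bend part: `pathShell ρ (ψ, 0) = (3ρ - R sin ψ, ρ - R cos ψ)`. [folklore] -/
theorem pathShell_zero_bend {ψ : ℝ} (h1 : Real.arctan (1 / 2) < ψ) (h2 : ψ ≤ π - Real.arctan 2) :
    pathShell ρ (ψ, 0) = (3 * ρ - bendR ρ ψ * Real.sin ψ, ρ - bendR ρ ψ * Real.cos ψ) := by
  rw [pathShell_eq_bend hρ (q := (ψ, 0)) h1 h2, bendPt]; simp

/-- **Abscissa bounds at zero offset**: `ρ ≤ X ≤ 4ρ` for `-π/4 ≤ ψ < π`. [folklore] -/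
theorem fst_pathShell_zero_mem {ψ : ℝ} (h1 : -(π / 4) ≤ ψ) (h2 : ψ < π) :
    ρ ≤ (pathShell ρ (ψ, 0)).1 ∧ (pathShell ρ (ψ, 0)).1 ≤ 4 * ρ := by
  have hπ := Real.pi_pos
  have hA2 := pi_div_three_lt_arctan_two
  have hah := arctan_half_lt_pi_div_six
  rcases lt_or_ge ψ (π / 6) with hlt | hge
  · rw [pathShell_zero_flat hρ hlt, flatU]
    have ht1 : -1 ≤ Real.tan ψ := by
      have := tan_le_tan_of_le (by linarith) h1 (by linarith)
      rwa [Real.tan_neg, Real.tan_pi_div_four] at this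
    have ht2 : Real.tan ψ ≤ 2 := by
      have := tan_le_tan_of_le (by linarith) hlt.le (by linarith)
      have h6 : Real.tan (π / 6) ≤ 2 := by rw [Real.tan_pi_div_six]; have := FP.inv_sqrt_three_bounds; linarith [this.2]
      linarith
    constructor <;> nlinarith
  rcases le_or_gt ψ (π / 2) with hle | hgt
  · rw [pathShell_zero_bend hρ (by linarith) (by linarith [Real.arctan_lt_pi_div_two (2:ℝ)])]
    obtain ⟨hR1, hR2⟩ := bendR_mem hρ (show -(π / 6) < ψ by linarith) (show ψ < 2 * π / 3 by linarith)
    have hs0 : 0 ≤ Real.sin ψ := Real.sin_nonneg_of_nonneg_of_le_pi (by linarith) (by linarith)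
    have hs1 : Real.sin ψ ≤ 1 := Real.sin_le_one ψ
    constructor
    · show ρ ≤ 3 * ρ - bendR ρ ψ * Real.sin ψ; nlinarith
    · show 3 * ρ - bendR ρ ψ * Real.sin ψ ≤ 4 * ρ; nlinarith
  · rw [pathShell_zero_foot hρ (by linarith)]
    constructor <;> simp <;> linarith

/-- Beyond the flat part the abscissa is at most `3ρ`. [folklore] -/
theorem fst_pathShell_zero_le {ψ : ℝ} (h1 : π / 6 ≤ ψ) (h2 : ψ < π) : (pathShell ρ (ψ, 0)).1 ≤ 3 * ρ := by
  have hπ := Real.pi_pos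
  have hA2 := pi_div_three_lt_arctan_two
  have hah := arctan_half_lt_pi_div_six
  rcases le_or_gt ψ (π / 2) with hle | hgt
  · rw [pathShell_zero_bend hρ (by linarith) (by linarith [Real.arctan_lt_pi_div_two (2:ℝ)])]
    obtain ⟨hR1, -⟩ := bendR_mem hρ (show -(π / 6) < ψ by linarith) (show ψ < 2 * π / 3 by linarith)
    have hs0 : 0 ≤ Real.sin ψ := Real.sin_nonneg_of_nonneg_of_le_pi (by linarith) (by linarith)
    show 3 * ρ - bendR ρ ψ * Real.sin ψ ≤ 3 * ρ; nlinarith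
  · rw [pathShell_zero_foot hρ (by linarith)]; simp; linarith

/-- **Ordinate bounds at zero offset** up to `π/2`: `|Y| ≤ ρ`. [folklore] -/
theorem abs_snd_pathShell_zero_le {ψ : ℝ} (h1 : -(π / 4) ≤ ψ) (h2 : ψ ≤ π / 2) : |(pathShell ρ (ψ, 0)).2| ≤ ρ := by
  have hπ := Real.pi_pos
  have hah := arctan_half_lt_pi_div_six
  rcases lt_or_ge ψ (π / 6) with hlt | hge
  · rw [pathShell_zero_flat hρ hlt]; simp; exact hρ.le
  · rw [pathShell_zero_bend hρ (by linarith) (by linarith [Real.arctan_lt_pi_div_two (2:ℝ)])]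
    obtain ⟨hR1, hR2⟩ := bendR_mem hρ (show -(π / 6) < ψ by linarith) (show ψ < 2 * π / 3 by linarith)
    have hc0 : 0 ≤ Real.cos ψ := Real.cos_nonneg_of_mem_Icc ⟨by linarith, h2⟩
    have hc1 : Real.cos ψ ≤ 1 := Real.cos_le_one ψ
    rw [abs_le]; constructor
    · show -ρ ≤ ρ - bendR ρ ψ * Real.cos ψ; nlinarith
    · show ρ - bendR ρ ψ * Real.cos ψ ≤ ρ; nlinarith

/-- Beyond `π/2` the ordinate is `y(ψ)`. [folklore] -/
theorem snd_pathShell_zero_eq {ψ : ℝ} (h : π / 2 < ψ) : (pathShell ρ (ψ, 0)).2 = footY ρ ψ := by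
  rw [pathShell_zero_foot hρ (by linarith [Real.pi_pos])]

end PathZero

/-! ### The two new points and old points -/

section NewPoints

variable {ε : ℝ} (hε : 0 < ε) (hε2 : ε ≤ 1 / 2)

/-- An old point is never the south new point `capEnd (0, a, b)`. [folklore] -/
theorem toSurg_ne_capEnd_zero (m : MTorus tubeShearDiffeo) (c a b : ℝ) :
    toSurg (fishNu hε hε2) m ≠ capEnd (fishNu hε hε2) c (0, a, b) := by
  intro h
  rw [toSurg, capEnd] at h
  have key : ∀ x, (fishNu hε hε2).glueData.inl x ≠ (fishNu hε hε2).glueData.inr (capEndPt c ((0:ℂ), a, b)) := by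
    intro x hx
    rw [SmoothGlueData.inl_eq_inr_iff] at hx
    have ht := (fishNu hε hε2).glueData.glue.map_source hx.1
    rw [hx.2, CircleNbhd.glueData_glue, CircleNbhd.glue_target] at ht
    apply ht
    show (Subtype.val (capEndPt c ((0:ℂ), a, b))).1 = 0
    rw [coe_capEndPt c (by simp)]; exact toE2_eq_zero_iff.2 rfl
  split_ifs at h <;> exact key _ h

/-- An old point is never the north new point `capEndN (0, a, b)`. [folklore] -/
theorem toSurg_ne_capEndN_zero (m : MTorus tubeShearDiffeo) (c a b : ℝ) :
    toSurg (fishNu hε hε2) m ≠ capEndN (fishNu hε hε2) c (0, a, b) := by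
  intro h
  rw [toSurg, capEndN] at h
  have key : ∀ x, (fishNu hε hε2).glueData.inl x ≠ (fishNu hε hε2).glueData.inr (reflD (capEndPt c ((0:ℂ), a, b))) := by
    intro x hx
    rw [SmoothGlueData.inl_eq_inr_iff] at hx
    have ht := (fishNu hε hε2).glueData.glue.map_source hx.1
    rw [hx.2, CircleNbhd.glueData_glue, CircleNbhd.glue_target] at ht
    apply ht
    show (Subtype.val (reflD (capEndPt c ((0:ℂ), a, b)))).1 = 0
    rw [coe_reflD, coe_capEndPt c (by simp)]; exact toE2_eq_zero_iff.2 rfl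
  split_ifs at h <;> exact key _ h

/-- The two new points are distinct. [folklore] -/
theorem capEnd_zero_ne_capEndN_zero (c : ℝ) :
    capEnd (fishNu hε hε2) c (0, 0, 0) ≠ capEndN (fishNu hε hε2) c (0, 0, 0) := by
  intro h
  rw [capEnd, capEndN] at h
  have h0 := (fishNu hε hε2).glueData.inr_injective h
  have h1 : (Subtype.val (capEndPt c ((0:ℂ), (0:ℝ), (0:ℝ)))).2 = reflS (Subtype.val (capEndPt c ((0:ℂ), (0:ℝ), (0:ℝ)))).2 := by
    conv_lhs => rw [h0]
    rw [coe_reflD]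
  rw [coe_capEndPt c (by simp)] at h1
  simp only [mul_zero] at h1
  have h2 := congrArg (fun θ : ↥(Metric.sphere (0 : 𝔼 3) 1) ↦ (θ : 𝔼 3) 0) h1
  simp only [coe_reflS] at h2
  rw [coe_thetaPt (by norm_num), reflX] at h2
  simp [thetaVec] at h2
  linarith

end NewPoints

namespace FP

variable {ε : ℝ} (hε : 0 < ε) (hε2 : ε ≤ 1 / 2)

/-! ### Numeric facts -/

/-- `1 - c_R ≤ 1/(2R₂²)`. [folklore] -/
theorem one_sub_cR_le : 1 - cR ≤ 1 / (2 * Rtwo ^ 2) := by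
  have hR := Rtwo_ge
  have hs : 0 < Real.sqrt (1 + Rtwo ^ 2) := Real.sqrt_pos.2 (by positivity)
  have hsq : Real.sqrt (1 + Rtwo ^ 2) ^ 2 = 1 + Rtwo ^ 2 := Real.sq_sqrt (by positivity)
  have hsR : Rtwo ≤ Real.sqrt (1 + Rtwo ^ 2) := by rw [Real.le_sqrt (by linarith) (by positivity)]; nlinarith
  -- `1 - R/s = (s - R)/s = 1/(s (s + R)) ≤ 1/(R · 2R)`
  rw [cR, show 1 - Rtwo / Real.sqrt (1 + Rtwo ^ 2) = (Real.sqrt (1 + Rtwo ^ 2) - Rtwo) / Real.sqrt (1 + Rtwo ^ 2) by field_simp]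
  have hkey : (Real.sqrt (1 + Rtwo ^ 2) - Rtwo) * (Real.sqrt (1 + Rtwo ^ 2) + Rtwo) = 1 := by nlinarith
  rw [div_le_div_iff₀ hs (by positivity)]
  nlinarith

include hε in
/-- **The north latitudes dominate `L₂ - 2π`**: `capLat (R₂ + 21/10) ≥ L₂ - 2π`. [folklore] -/
theorem capLat_far_ge : L2 ε - 2 * π ≤ capLat ε (Rtwo + 21 / 10) := by
  have hR := Rtwo_ge
  set t := Rtwo + 21 / 10 with ht
  have ht0 : 0 < t := by linarith
  have hs : 0 < Real.sqrt (1 + t ^ 2) := Real.sqrt_pos.2 (by positivity)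
  have hsq : Real.sqrt (1 + t ^ 2) ^ 2 = 1 + t ^ 2 := Real.sq_sqrt (by positivity)
  have hst : t ≤ Real.sqrt (1 + t ^ 2) := by rw [Real.le_sqrt (by linarith) (by positivity)]; nlinarith
  have hst' : Real.sqrt (1 + t ^ 2) ≤ t + 1 / (2 * t) := by
    rw [Real.sqrt_le_left (by positivity)]
    have : (t + 1 / (2 * t)) ^ 2 = t ^ 2 + 1 + 1 / (4 * t ^ 2) := by field_simp; ring
    rw [this]; have : 0 < 1 / (4 * t ^ 2) := by positivity
    linarith
  have h1c : 1 / (2 * t ^ 2 + 2) ≤ 1 - t / Real.sqrt (1 + t ^ 2) := by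
    rw [show 1 - t / Real.sqrt (1 + t ^ 2) = (Real.sqrt (1 + t ^ 2) - t) / Real.sqrt (1 + t ^ 2) by field_simp]
    rw [div_le_div_iff₀ (by positivity) hs]
    have hkey : (Real.sqrt (1 + t ^ 2) - t) * (Real.sqrt (1 + t ^ 2) + t) = 1 := by nlinarith
    nlinarith
  have h2c := one_sub_cR_le
  rw [L2, capLat]
  have hfin : (1 - cR) / 2 ≤ 1 - t / Real.sqrt (1 + t ^ 2) := by
    refine le_trans ?_ h1c
    rw [div_le_iff₀ (by norm_num : (0:ℝ) < 2)]
    refine h2c.trans ?_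
    rw [div_mul_eq_mul_div, one_mul, div_le_div_iff₀ (by positivity) (by positivity)]
    rw [ht]; nlinarith
  have key : t / Real.sqrt (1 + t ^ 2) ≤ (1 + cR) / 2 := by linarith
  rw [show -ε * t / Real.sqrt (1 + t ^ 2) = -(ε * (t / Real.sqrt (1 + t ^ 2))) by ring]
  nlinarith [mul_le_mul_of_nonneg_left key hε.le]

/-- `‖tdisc w‖ ≤ ‖w‖ + ‖d₀‖`. [folklore] -/
theorem norm_tdisc_le (T : TubeDData) (w : ℂ) : ‖T.tdisc w‖ ≤ ‖w‖ + ‖capD0 T.ε T.nj‖ := by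
  rw [TubeDData.tdisc, coe_transDisc, transFun]
  have h0 := Real.smoothTransition.nonneg (transArg T.R₁ T.R₂ w)
  have h1 := Real.smoothTransition.le_one (transArg T.R₁ T.R₂ w)
  have h2 : ‖1 - Real.smoothTransition (transArg T.R₁ T.R₂ w)‖ ≤ 1 := by
    rw [Real.norm_eq_abs, abs_le]; constructor <;> linarith
  have h3 : ‖(1 - Real.smoothTransition (transArg T.R₁ T.R₂ w)) • capD0 T.ε T.nj‖ ≤ ‖capD0 T.ε T.nj‖ := by
    rw [norm_smul]; exact mul_le_of_le_one_left (norm_nonneg _) h2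
  exact (norm_add_le _ _).trans (by linarith)

/-! ### Range facts for the reference data -/

section Ranges

/-- `s₂ < s₃ < r₀ - 1/√3`. [folklore] -/
theorem s2_lt_s3 (hε : 0 < ε) (hε2 : ε ≤ 1 / 2) : s2 ε < s3 ε ∧ s3 ε < rzero ε - 1 / Real.sqrt 3 := by
  obtain ⟨hs1, hs2⟩ := s2_bounds hε hε2
  obtain ⟨hi1, hi2⟩ := inv_sqrt_three_bounds
  have hη := eta_pos ε hε
  have hr0 : rzero ε = 12 + ε / 100 := by unfold rzero b2; ring
  unfold s3; rw [hr0]; constructor <;> linarith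

include hε hε2 in
/-- `nfun s₂ = L₂`. [folklore] -/
theorem nfun_s2 : (fishTref ε hε hε2).nfun (s2 ε) = L2 ε := by
  obtain ⟨hs1, hs2⟩ := s2_bounds hε hε2
  rw [fishTref_eq, nfun_eq_L2 hε hε2 (by linarith) (by linarith [eta_pos ε hε])]; ring

include hε2 in
/-- **South/annulus latitudes lie in `(0, L₂)`** for `0 < r < s₂`. [folklore] -/
theorem nfun_mem_SA {r : ℝ} (h0 : 0 < r) (h1 : r < s2 ε) :
    0 < (fishTref ε hε hε2).nfun r ∧ (fishTref ε hε hε2).nfun r < L2 ε := by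
  obtain ⟨h23, h3⟩ := s2_lt_s3 hε hε2
  refine ⟨by rw [fishTref_eq]; exact nfun_pos hε hε2 h0 (by linarith), ?_⟩
  rw [← nfun_s2 hε hε2, fishTref_eq]
  exact strictMonoOn_nfun hε hε2 ⟨h0, by linarith⟩ ⟨by linarith, by linarith⟩ h1

include hε hε2 in
/-- `L₂ < 2π` and `2π - ε < L₂`. [folklore] -/
theorem L2_bounds : 2 * π - ε < L2 ε ∧ L2 ε < 2 * π := by
  have h1 := cR_lt_one; have h2 := cR_pos
  unfold L2; constructor <;> nlinarith

include hε2 in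
/-- Injectivity of the latitude profile below `r₀ - 1/√3`. [folklore] -/
theorem nfun_inj {r r' : ℝ} (h0 : 0 < r) (h1 : r < rzero ε - 1 / Real.sqrt 3) (h0' : 0 < r') (h1' : r' < rzero ε - 1 / Real.sqrt 3)
    (h : (fishTref ε hε hε2).nfun r = (fishTref ε hε hε2).nfun r') : r = r' := by
  rw [fishTref_eq] at h
  exact (strictMonoOn_nfun hε hε2 (c := 1) (ρb := Lc ε) (μ := fun _ ↦ 0)).injOn ⟨h0, h1⟩ ⟨h0', h1'⟩ h

include hε2 in
/-- On the north window: `capLat (P r) = nfun r - 2π`, `P r > 0`. [folklore] -/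
theorem capLat_Pfun {r : ℝ} (h1 : s2 ε ≤ r) (h2 : r < rzero ε - 1 / Real.sqrt 3) :
    capLat ε ((fishTref ε hε hε2).Pfun r) = (fishTref ε hε hε2).nfun r - 2 * π ∧ 0 < (fishTref ε hε hε2).Pfun r := by
  have hη := eta_pos ε hε
  rw [fishTref_eq] at *
  obtain ⟨h3, h4⟩ := nfun_winN' hε hε2 (c := 1) (ρb := Lc ε) (μ := fun _ ↦ 0) (by linarith) h2
  exact ⟨by rw [Pfun_eq, capLat_capRad hε h3], Pfun_pos hε hε2 (by linarith) h2⟩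

include hε2 in
/-- **Injectivity of `P` on the north window.** [folklore] -/
theorem Pfun_inj {r r' : ℝ} (h1 : s2 ε ≤ r) (h2 : r < rzero ε - 1 / Real.sqrt 3) (h1' : s2 ε ≤ r') (h2' : r' < rzero ε - 1 / Real.sqrt 3)
    (h : (fishTref ε hε hε2).Pfun r = (fishTref ε hε hε2).Pfun r') : r = r' := by
  obtain ⟨hs1, -⟩ := s2_bounds hε hε2
  have e1 := (capLat_Pfun hε hε2 h1 h2).1
  have e2 := (capLat_Pfun hε hε2 h1' h2').1
  rw [h, e2] at e1
  exact nfun_inj hε hε2 (by linarith) h2 (by linarith) h2' (by linarith)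

include hε2 in
/-- **`P` decreases across the north window**: `P r' < P r` for `r < r'`. [folklore] -/
theorem Pfun_lt_Pfun {r r' : ℝ} (h1 : s2 ε ≤ r) (hrr' : r < r') (h2' : r' < rzero ε - 1 / Real.sqrt 3) :
    (fishTref ε hε hε2).Pfun r' < (fishTref ε hε hε2).Pfun r := by
  obtain ⟨hs1, -⟩ := s2_bounds hε hε2
  have h2 : r < rzero ε - 1 / Real.sqrt 3 := hrr'.trans h2'
  obtain ⟨e1, -⟩ := capLat_Pfun hε hε2 h1 h2
  obtain ⟨e2, -⟩ := capLat_Pfun hε hε2 (h1.trans hrr'.le) h2'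
  have hlt : (fishTref ε hε hε2).nfun r < (fishTref ε hε hε2).nfun r' := by
    rw [fishTref_eq]; exact strictMonoOn_nfun hε hε2 ⟨by linarith, h2⟩ ⟨by linarith, h2'⟩ hrr'
  have key : capLat ε ((fishTref ε hε hε2).Pfun r) < capLat ε ((fishTref ε hε hε2).Pfun r') := by rw [e1, e2]; linarith
  by_contra hcon
  rcases (not_lt.1 hcon).lt_or_eq with hlt | heq
  · exact absurd key (not_lt.2 (strictAnti_capLat hε hlt).le)
  · rw [heq] at key; exact lt_irrefl _ key

include hε2 in
/-- **`P` on the north window exceeds the flat abscissa at `s₃`.** [folklore] -/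
theorem flatU_s3_lt_Pfun {r : ℝ} (h1 : s2 ε ≤ r) (h2 : r < s3 ε) :
    flatU ρA (angleUp (rzero ε) (s3 ε)) < (fishTref ε hε hε2).Pfun r := by
  obtain ⟨h23, h3⟩ := s2_lt_s3 hε hε2
  have hP3 := (Pfun_slab3 hε hε2 (c := 1) (ρb := Lc ε) (μ := fun _ ↦ 0) (r := s3 ε) (by simp)).1
  rw [← fishTref_eq] at hP3
  rw [← hP3]; exact Pfun_lt_Pfun hε hε2 h1 h2 h3

/-- `3ρ_A < u₀(α(s₃)) ` (`tan α(s₃) < 0`). [folklore] -/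
theorem three_rhoA_lt_flatU_s3 : 3 * ρA < flatU ρA (angleUp (rzero ε) (s3 ε)) := by
  obtain ⟨h1, h2⟩ := alpha_slab3 (ε := ε) (r := s3 ε) (by simp)
  have ht : Real.tan (angleUp (rzero ε) (s3 ε)) < 0 := by
    have := Real.tan_lt_tan_of_lt_of_lt_pi_div_two (by linarith [Real.pi_pos]) (by linarith [Real.pi_pos]) h2
    rwa [Real.tan_zero] at this
  unfold flatU; have := ρA_pos; nlinarith

/-- **The upper abscissa never exceeds `u₀(α(s₃))`** on `[s₃, s₄ + 1/10)`. [folklore] -/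
theorem fst_pathShell_alpha_le {r : ℝ} (h1 : s3 ε ≤ r) (h2 : r < s4 ε + 1 / 10) :
    (pathShell ρA (angleUp (rzero ε) r, 0)).1 ≤ flatU ρA (angleUp (rzero ε) (s3 ε)) := by
  have hπ := Real.pi_pos
  have hρ := ρA_pos
  obtain ⟨hα1, hα2⟩ := alpha_winU5 (ε := ε) (r := r) (by linarith) h2
  obtain ⟨h31, h32⟩ := alpha_slab3 (ε := ε) (r := s3 ε) (by simp)
  have hmono : angleUp (rzero ε) (s3 ε) ≤ angleUp (rzero ε) r := (strictMono_angleUp _).monotone h1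
  rcases lt_or_ge (angleUp (rzero ε) r) (π / 6) with hlt | hge
  · rw [pathShell_zero_flat hρ hlt, flatU, flatU]
    have := tan_le_tan_of_le (by linarith) hmono (by linarith)
    nlinarith
  · exact (fst_pathShell_zero_le hρ hge (by linarith)).trans (three_rhoA_lt_flatU_s3 (ε := ε)).le

end Ranges

/-! ### Window order -/

section Order

include hε hε2 in
/-- The window thresholds in order, with the margins used below. [folklore] -/
theorem windows :
    3 / 4 < s2 ε ∧ s2 ε < s3 ε ∧ s3 ε + 1 / 5 < s4 ε ∧ s4 ε + 1 / 5 < s5 ε ∧ s5 ε + 1 / 5 < s6 ε ∧ s6 ε + 1 / 5 < s7 ε ∧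
      s6 ε < rone ε + 1 / Real.sqrt 3 ∧ s7 ε - 3 / 100 < rone ε + 1 / Real.sqrt 3 + 1 ∧ Rdisc ε = s7 ε + 1 := by
  obtain ⟨hs1, hs2⟩ := s2_bounds hε hε2
  obtain ⟨hi1, hi2⟩ := inv_sqrt_three_bounds
  obtain ⟨hq1, hq2⟩ := sqrt_three_bounds
  have hη := eta_pos ε hε
  have hr0 : rzero ε = 12 + ε / 100 := by unfold rzero b2; ring
  have hR : Rdisc ε = s7 ε + 1 := rfl
  refine ⟨?_, ?_, ?_, ?_, ?_, ?_, ?_, ?_, hR⟩ <;> simp only [s3, s4, s5, s6, s7, rone, hr0] at * <;> linarith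

end Order

/-! ### Dispatch of the reference disc to its windows -/

section Dispatch

/-- `discRef hε hε2 ζ = (fishTref ε hε hε2).winS (ζ, 0, 0)`. [folklore] -/
theorem discRef_S {ζ : ℂ} (h : ‖ζ‖ < 3 / 4) : discRef hε hε2 ζ = (fishTref ε hε hε2).winS (ζ, 0, 0) := by
  rw [discRef, TubeDData.tubeD, glueBy_of_lt (τ := fun q : ℂ × ℝ × ℝ ↦ ‖q.1‖) (by exact h)]

/-- `discRef hε hε2 ζ = (fishTref ε hε hε2).winA (ζ, 0, 0)`. [folklore] -/
theorem discRef_A {ζ : ℂ} (h1 : 3 / 4 ≤ ‖ζ‖) (h2 : ‖ζ‖ < s2 ε) : discRef hε hε2 ζ = (fishTref ε hε hε2).winA (ζ, 0, 0) := by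
  rw [discRef, TubeDData.tubeD, glueBy_of_le (τ := fun q : ℂ × ℝ × ℝ ↦ ‖q.1‖) (by exact h1),
    glueBy_of_lt (τ := fun q : ℂ × ℝ × ℝ ↦ ‖q.1‖) (by exact h2)]

/-- `discRef hε hε2 ζ = (fishTref ε hε hε2).winN (ζ, 0, 0)`. [folklore] -/
theorem discRef_N {ζ : ℂ} (h1 : s2 ε ≤ ‖ζ‖) (h2 : ‖ζ‖ < s3 ε) : discRef hε hε2 ζ = (fishTref ε hε hε2).winN (ζ, 0, 0) := by
  have h0 : (3:ℝ) / 4 ≤ ‖ζ‖ := by linarith [(s2_bounds hε hε2).1]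
  rw [discRef, TubeDData.tubeD, glueBy_of_le (τ := fun q : ℂ × ℝ × ℝ ↦ ‖q.1‖) (by exact h0),
    glueBy_of_le (τ := fun q : ℂ × ℝ × ℝ ↦ ‖q.1‖) (by exact h1), glueBy_of_lt (τ := fun q : ℂ × ℝ × ℝ ↦ ‖q.1‖) (by exact h2)]

/-- Past the north window. [folklore] -/
theorem discRef_ge_s3 {ζ : ℂ} (h : s3 ε ≤ ‖ζ‖) : discRef hε hε2 ζ =
    glueBy (fun q : ℂ × ℝ × ℝ ↦ ‖q.1‖) (s4 ε) (fishTref ε hε hε2).winU5 (glueBy (fun q ↦ ‖q.1‖) (s5 ε) (fishTref ε hε hε2).winU4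
      (glueBy (fun q ↦ ‖q.1‖) (s6 ε) (fishTref ε hε hε2).winU3
        (glueBy (fun q ↦ ‖q.1‖) (s7 ε) (fishTref ε hε hε2).winU2 (fishTref ε hε hε2).winU1))) (ζ, 0, 0) := by
  obtain ⟨w1, w2, -⟩ := windows hε hε2
  rw [discRef, TubeDData.tubeD, glueBy_of_le (τ := fun q : ℂ × ℝ × ℝ ↦ ‖q.1‖) (by show (3:ℝ) / 4 ≤ ‖ζ‖; linarith),
    glueBy_of_le (τ := fun q : ℂ × ℝ × ℝ ↦ ‖q.1‖) (by show s2 ε ≤ ‖ζ‖; linarith),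
    glueBy_of_le (τ := fun q : ℂ × ℝ × ℝ ↦ ‖q.1‖) (by exact h)]
  rfl

end Dispatch

/-! ### The upper data -/

section Upper

/-- Abscissa and ordinate of the U5 profile, and its chart point. [folklore] -/
def X5 (ε : ℝ) (r : ℝ) : ℝ := (pathShell ρA (angleUp (rzero ε) r, 0)).1
/-- The constant `Y5 = (pathShell ρA (angleUp (rzero ε) r, 0)).2` of the fishtail data. [folklore] -/
def Y5 (ε : ℝ) (r : ℝ) : ℝ := (pathShell ρA (angleUp (rzero ε) r, 0)).2
/-- The decoded fifth invariant of a `D⁰` point. [folklore] -/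
def d5 (ε : ℝ) (r ϑ : ℝ) : ℂ := capD0 ε (nj ε) + (X5 ε r : ℂ) * exp (ϑ * I)
/-- Height of the U4 profile and its chart point. [folklore] -/
def y4 (ε : ℝ) (r : ℝ) : ℝ := footY ρA (angleUp (rzero ε) r)
/-- The decoded fourth invariant of a `D⁰` point. [folklore] -/
def d4 (ε : ℝ) (r ϑ : ℝ) : ℂ := capD0 ε (nj ε) + (uU ρA (y4 ε r) : ℂ) * exp (ϑ * I)
/-- Abscissa and ordinate of the U2 profile. [folklore] -/
def X2 (ε : ℝ) (r : ℝ) : ℝ := (pathShell R0 (angleDown (rone ε) r, 0)).1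
/-- The constant `Y2 = (pathShell R0 (angleDown (rone ε) r, 0)).2` of the fishtail data. [folklore] -/
def Y2 (ε : ℝ) (r : ℝ) : ℝ := (pathShell R0 (angleDown (rone ε) r, 0)).2
/-- Time of the U1 profile. [folklore] -/
def S1 (r : ℝ) : ℝ := 1 + bxH * ((fishTref ε hε hε2).posL r - Lc ε)

/-- **The latitude datum of the upper pieces.** [folklore] -/
def uN (ε : ℝ) (r ϑ : ℝ) : ℝ :=
  if r < s4 ε then capN ε (d5 ε r ϑ) else if r < s5 ε then capN ε (d4 ε r ϑ) else nj ε

/-- **The height datum of the upper pieces.** [folklore] -/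
def uY (r : ℝ) : ℝ :=
  if r < s4 ε then Y5 ε r else if r < s5 ε then y4 ε r else if r < s6 ε then (fishTref ε hε hε2).yfun r
    else if r < s7 ε then cY - Y2 ε r else cY

/-- **The base datum of the upper pieces.** [folklore] -/
def uS (r ϑ : ℝ) : ℝ :=
  if r < s4 ε then capS (d5 ε r ϑ) else if r < s5 ε then capS (d4 ε r ϑ) else if r < s6 ε then 3 / 4
    else if r < s7 ε then 3 / 4 - 2 * R0 + X2 ε r else S1 hε hε2 r

/-- **The reference disc over the upper pieces** is the physical point with data `(uN, uY, uS)`. [folklore] -/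
theorem discRef_U {ζ : ℂ} (h : s3 ε ≤ ‖ζ‖) :
    discRef hε hε2 ζ = uPt hε hε2 (uN ε ‖ζ‖ (arg ζ)) (uY hε hε2 ‖ζ‖) (arg ζ) (uS hε hε2 ‖ζ‖ (arg ζ)) := by
  rw [discRef_ge_s3 hε hε2 h, uN, uY, uS]
  by_cases h4 : ‖ζ‖ < s4 ε
  · rw [glueBy_of_lt (τ := fun q : ℂ × ℝ × ℝ ↦ ‖q.1‖) (by exact h4), if_pos h4, if_pos h4, if_pos h4, winU5_zero]; rfl
  rw [glueBy_of_le (τ := fun q : ℂ × ℝ × ℝ ↦ ‖q.1‖) (not_lt.1 h4), if_neg h4, if_neg h4, if_neg h4]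
  by_cases h5 : ‖ζ‖ < s5 ε
  · rw [glueBy_of_lt (τ := fun q : ℂ × ℝ × ℝ ↦ ‖q.1‖) (by exact h5), if_pos h5, if_pos h5, if_pos h5, winU4_zero]; rfl
  rw [glueBy_of_le (τ := fun q : ℂ × ℝ × ℝ ↦ ‖q.1‖) (not_lt.1 h5), if_neg h5, if_neg h5, if_neg h5]
  by_cases h6 : ‖ζ‖ < s6 ε
  · rw [glueBy_of_lt (τ := fun q : ℂ × ℝ × ℝ ↦ ‖q.1‖) (by exact h6), if_pos h6, if_pos h6, winU3_zero]
  rw [glueBy_of_le (τ := fun q : ℂ × ℝ × ℝ ↦ ‖q.1‖) (not_lt.1 h6), if_neg h6, if_neg h6]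
  by_cases h7 : ‖ζ‖ < s7 ε
  · rw [glueBy_of_lt (τ := fun q : ℂ × ℝ × ℝ ↦ ‖q.1‖) (by exact h7), if_pos h7, if_pos h7, winU2_zero]; rfl
  · rw [glueBy_of_le (τ := fun q : ℂ × ℝ × ℝ ↦ ‖q.1‖) (not_lt.1 h7), if_neg h7, if_neg h7, winU1_zero]; rfl

/-! #### Chart points near `d₀` -/

include hε in
/-- A chart point `d₀ + w`, `‖w‖ ≤ 1/5`: `im < 0`, nonzero, `‖·‖ ≤ 23/10`. [folklore] -/
theorem d0_add_mem {w : ℂ} (hw : ‖w‖ ≤ 1 / 5) :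
    (capD0 ε (nj ε) + w).im < 0 ∧ capD0 ε (nj ε) + w ≠ 0 ∧ ‖capD0 ε (nj ε) + w‖ ≤ 23 / 10 := by
  obtain ⟨ht1, ht2⟩ := capTj_bounds (ε := ε) hε
  have him : (capD0 ε (nj ε) + w).im = -capTj ε (nj ε) + w.im := by rw [add_im, capD0_eq]; simp
  have hwi : |w.im| ≤ 1 / 5 := (abs_im_le_norm w).trans hw
  have h1 : (capD0 ε (nj ε) + w).im < 0 := by rw [him]; linarith [(abs_le.1 hwi).2]
  refine ⟨h1, fun h0 ↦ by rw [h0] at h1; simp at h1, ?_⟩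
  calc ‖capD0 ε (nj ε) + w‖ ≤ ‖capD0 ε (nj ε)‖ + ‖w‖ := norm_add_le _ _
    _ ≤ 23 / 10 := by rw [norm_capD0 (nj_sq_lt ε hε) (nj_neg ε hε)]; linarith

/-- `capS d ∈ (1/2, 1)` when `im d < 0`. [folklore] -/
theorem capS_mem_of_im_neg {d : ℂ} (h : d.im < 0) : 1 / 2 < capS d ∧ capS d < 1 := by
  have hπ := Real.pi_pos
  have h1 : arg d < 0 := Complex.arg_neg_iff.2 h
  have h2 := Complex.neg_pi_lt_arg d
  rw [capS]; constructor
  · rw [show (1:ℝ) / 2 = -π / (2 * π) + 1 by field_simp; ring]; gcongr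
  · have : arg d / (2 * π) < 0 := div_neg_of_neg_of_pos h1 (by positivity)
    linarith

include hε in
/-- `capN d ∈ (-ε, 0)` for `d ≠ 0`. [folklore] -/
theorem capN_mem {d : ℂ} (hd : d ≠ 0) : -ε < capN ε d ∧ capN ε d < 0 := by
  have h1 := neg_capN_pos hε hd; have h2 := neg_capN_lt_eps hε d
  constructor <;> linarith

include hε in
/-- **Latitudes of chart points within `R₂ + 21/10` dominate `L₂ - 2π`.** [folklore] -/
theorem capN_ge_of_norm_le {d : ℂ} (h : ‖d‖ ≤ Rtwo + 21 / 10) : L2 ε - 2 * π ≤ capN ε d := by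
  refine (capLat_far_ge hε).trans ?_
  rw [capN]
  rcases h.lt_or_eq with hlt | heq
  · exact (strictAnti_capLat hε hlt).le
  · rw [heq]

/-- Recovering a complex number from its latitude and argument. [folklore] -/
theorem eq_of_capN_eq_arg_eq (hε : 0 < ε) {d d' : ℂ} (hn : capN ε d = capN ε d') (ha : arg d = arg d') : d = d' := by
  have hnorm : ‖d‖ = ‖d'‖ := by
    rw [capN, capN] at hn
    by_contra hne
    rcases lt_or_gt_of_ne hne with hlt | hlt
    · exact absurd hn (strictAnti_capLat hε hlt).ne'
    · exact absurd hn (strictAnti_capLat hε hlt).ne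
  rw [← norm_mul_exp_arg_mul_I d, ← norm_mul_exp_arg_mul_I d', hnorm, ha]

/-! #### Ranges of the upper data -/

include hε hε2 in
/-- **U5 data**: `X₅ ∈ [ρ_A, 4ρ_A]`, `-ρ_A ≤ Y₅ < y(α(s₄))`, and `α < α(s₄)`. [folklore] -/
theorem U5_mem {r : ℝ} (h1 : s3 ε ≤ r) (h2 : r < s4 ε) :
    ρA ≤ X5 ε r ∧ X5 ε r ≤ 4 * ρA ∧ -ρA ≤ Y5 ε r ∧ Y5 ε r < footY ρA (angleUp (rzero ε) (s4 ε)) := by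
  have hπ := Real.pi_pos
  have hρ := ρA_pos
  obtain ⟨-, -, w34, -⟩ := windows hε hε2
  obtain ⟨hα1, hα2⟩ := alpha_winU5 (ε := ε) (r := r) (by linarith) (by linarith)
  obtain ⟨h41, h42⟩ := alpha_slab4 (ε := ε) (r := s4 ε) (by simp)
  have hlt : angleUp (rzero ε) r < angleUp (rzero ε) (s4 ε) := strictMono_angleUp _ h2
  obtain ⟨hX1, hX2⟩ := fst_pathShell_zero_mem hρ hα1.le (by linarith)
  refine ⟨hX1, hX2, ?_, ?_⟩
  · rcases le_or_gt (angleUp (rzero ε) r) (π / 2) with hle | hgt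
    · exact (abs_le.1 (abs_snd_pathShell_zero_le hρ hα1.le hle)).1
    · rw [Y5, snd_pathShell_zero_eq hρ hgt]
      have := footY_le_footY hρ (show 0 < π / 2 by linarith) hgt.le (by linarith)
      rw [footY, Real.cos_pi_div_two, zero_div, mul_zero, sub_zero] at this; linarith
  · have hmid : ρA < footY ρA (angleUp (rzero ε) (s4 ε)) := by
      have := strictMonoOn_footY hρ ⟨by linarith, by linarith⟩ ⟨by linarith, by linarith⟩ h41
      rwa [footY, Real.cos_pi_div_two, zero_div, mul_zero, sub_zero] at this
    rcases le_or_gt (angleUp (rzero ε) r) (π / 2) with hle | hgt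
    · exact lt_of_le_of_lt (abs_le.1 (abs_snd_pathShell_zero_le hρ hα1.le hle)).2 hmid
    · rw [Y5, snd_pathShell_zero_eq hρ hgt]
      exact strictMonoOn_footY hρ ⟨by linarith, by linarith⟩ ⟨by linarith, by linarith⟩ hlt

include hε hε2 in
/-- **U4 data**: `y(α(s₄)) ≤ y₄ < y(α(s₅)) ≤ 3/10`, `uU ∈ [0, 2ρ_A]`. [folklore] -/
theorem U4_mem {r : ℝ} (h1 : s4 ε ≤ r) (h2 : r < s5 ε) :
    footY ρA (angleUp (rzero ε) (s4 ε)) ≤ y4 ε r ∧ y4 ε r < footY ρA (angleUp (rzero ε) (s5 ε)) ∧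
      footY ρA (angleUp (rzero ε) (s5 ε)) ≤ 3 / 10 ∧ 0 < footY ρA (angleUp (rzero ε) (s4 ε)) := by
  have hπ := Real.pi_pos
  have hρ := ρA_pos
  obtain ⟨-, -, w34, w45, -⟩ := windows hε hε2
  obtain ⟨h41, h42⟩ := alpha_slab4 (ε := ε) (r := s4 ε) (by simp)
  obtain ⟨h51, h52⟩ := alpha_slab5 (ε := ε) (r := s5 ε) (by simp)
  obtain ⟨-, -, hy5, -⟩ := yfun_slab5 hε hε2 (c := 1) (ρb := Lc ε) (μ := fun _ ↦ 0) (r := s5 ε) (by simp)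
  have hαr := alpha_gt_pi_div_two (ε := ε) (r := r) (by linarith)
  have hαr' : angleUp (rzero ε) r < π := (angleUp_mem _ _).2
  have hle : angleUp (rzero ε) (s4 ε) ≤ angleUp (rzero ε) r := (strictMono_angleUp _).monotone h1
  have hlt : angleUp (rzero ε) r < angleUp (rzero ε) (s5 ε) := strictMono_angleUp _ h2
  refine ⟨footY_le_footY hρ (by linarith) hle hαr', strictMonoOn_footY hρ ⟨by linarith, hαr'⟩ ⟨by linarith, by linarith⟩ hlt, hy5, ?_⟩
  have := footY_le_footY hρ (show 0 < π / 2 by linarith) h41.le (by linarith)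
  rw [footY, Real.cos_pi_div_two, zero_div, mul_zero, sub_zero] at this; linarith

include hε2 in
/-- **`yfun` is strictly increasing on `(s₄ - 1/10, r₁ + 1/√3)`.** [folklore] -/
theorem strictMonoOn_yfun : StrictMonoOn (fishTref ε hε hε2).yfun (Ioo (s4 ε - 1 / 10) (rone ε + 1 / Real.sqrt 3)) := by
  refine strictMonoOn_of_deriv_pos (convex_Ioo _ _)
    (fun r hr ↦ (deriv_yfun_pos hε hε2 (c := 1) (ρb := Lc ε) (μ := fun _ ↦ 0) hr.1 hr.2).2.continuousAt.continuousWithinAt) fun r hr ↦ ?_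
  rw [interior_Ioo] at hr
  exact (deriv_yfun_pos hε hε2 (c := 1) (ρb := Lc ε) (μ := fun _ ↦ 0) hr.1 hr.2).1

include hε2 in
/-- **U3 data**: `y(α(s₅)) ≤ yfun r < yfun s₆ = c_Y - y_{R₀}(β(s₆))`. [folklore] -/
theorem U3_mem {r : ℝ} (h1 : s5 ε ≤ r) (h2 : r < s6 ε) :
    footY ρA (angleUp (rzero ε) (s5 ε)) ≤ (fishTref ε hε hε2).yfun r ∧
      (fishTref ε hε hε2).yfun r < cY - footY R0 (angleDown (rone ε) (s6 ε)) ∧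
      2 * R0 ≤ footY R0 (angleDown (rone ε) (s6 ε)) ∧ footY R0 (angleDown (rone ε) (s6 ε)) ≤ 3 / 5 := by
  obtain ⟨-, -, w34, w45, w56, w67, w6, -⟩ := windows hε hε2
  obtain ⟨hy5, -⟩ := yfun_slab5 hε hε2 (c := 1) (ρb := Lc ε) (μ := fun _ ↦ 0) (r := s5 ε) (by simp)
  obtain ⟨hy6, h6a, h6b, -⟩ := yfun_slab6 hε hε2 (c := 1) (ρb := Lc ε) (μ := fun _ ↦ 0) (r := s6 ε) (by simp)
  rw [← fishTref_eq] at hy5 hy6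
  have hmono := strictMonoOn_yfun hε hε2
  refine ⟨?_, ?_, h6a, h6b⟩
  · rw [← hy5]; exact hmono.monotoneOn ⟨by linarith, by linarith⟩ ⟨by linarith, by linarith⟩ h1
  · rw [← hy6]; exact hmono ⟨by linarith, by linarith⟩ ⟨by linarith, by linarith⟩ h2

include hε hε2 in
/-- **U2 data**: `X₂ ∈ [R₀, 4R₀]`, `-R₀ ≤ Y₂ ≤ y_{R₀}(β(s₆))`, `β ∈ (β₇…]`. [folklore] -/
theorem U2_mem {r : ℝ} (h1 : s6 ε ≤ r) (h2 : r < s7 ε) :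
    R0 ≤ X2 ε r ∧ X2 ε r ≤ 4 * R0 ∧ -R0 ≤ Y2 ε r ∧ Y2 ε r ≤ footY R0 (angleDown (rone ε) (s6 ε)) := by
  have hπ := Real.pi_pos
  have hρ := R0_pos
  obtain ⟨-, -, -, -, w56, w67, w6, -⟩ := windows hε hε2
  obtain ⟨hβ1, hβ2⟩ := beta_winU2 (ε := ε) (r := r) (by linarith) (by linarith)
  obtain ⟨h61, h62, -⟩ := beta_slab6 (ε := ε) (r := s6 ε) (by simp)
  have hβπ : angleDown (rone ε) r < π := (angleDown_mem _ _).2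
  have hle : angleDown (rone ε) r ≤ angleDown (rone ε) (s6 ε) := (strictAnti_angleDown _).antitone h1
  obtain ⟨hX1, hX2⟩ := fst_pathShell_zero_mem hρ hβ1.le hβπ
  refine ⟨hX1, hX2, ?_, ?_⟩
  · rcases le_or_gt (angleDown (rone ε) r) (π / 2) with hle' | hgt
    · exact (abs_le.1 (abs_snd_pathShell_zero_le hρ hβ1.le hle')).1
    · rw [Y2, snd_pathShell_zero_eq hρ hgt]
      have := footY_le_footY hρ (show 0 < π / 2 by linarith) hgt.le hβπ
      rw [footY, Real.cos_pi_div_two, zero_div, mul_zero, sub_zero] at this; linarith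
  · have hmid : R0 ≤ footY R0 (angleDown (rone ε) (s6 ε)) := by
      have := footY_le_footY hρ (show 0 < π / 2 by linarith) (by linarith : π / 2 ≤ angleDown (rone ε) (s6 ε)) h62
      rwa [footY, Real.cos_pi_div_two, zero_div, mul_zero, sub_zero] at this
    rcases le_or_gt (angleDown (rone ε) r) (π / 2) with hle' | hgt
    · exact le_trans (abs_le.1 (abs_snd_pathShell_zero_le hρ hβ1.le hle')).2 hmid
    · rw [Y2, snd_pathShell_zero_eq hρ hgt]
      exact footY_le_footY hρ (by linarith) hle h62

include hε2 in
/-- **`posL` is strictly increasing beyond `s₇ - 3/100`.** [folklore] -/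
theorem strictMonoOn_posL : StrictMonoOn (fishTref ε hε hε2).posL (Ioi (s7 ε - 3 / 100)) := by
  have hcρ : (1:ℝ) * Lc ε = Lc ε := one_mul _
  refine strictMonoOn_of_deriv_pos (convex_Ioi _)
    (fun r hr ↦ (deriv_posL_pos hε hε2 (c := 1) (ρb := Lc ε) (μ := fun _ ↦ 0) hcρ hr).2.continuousAt.continuousWithinAt) fun r hr ↦ ?_
  rw [interior_Ioi] at hr
  exact (deriv_posL_pos hε hε2 (c := 1) (ρb := Lc ε) (μ := fun _ ↦ 0) hcρ hr).1

include hε2 in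
/-- `posL s₇ = L_c - 1/4 - tan β₇`. [folklore] -/
theorem posL_s7 : (fishTref ε hε hε2).posL (s7 ε) = Lc ε - 1 / 4 - Real.tan (beta7 ε) := by
  have hη := eta_pos ε hε
  rw [fishTref_eq, posL_eq, blendFun, stdBlend_of_le (by unfold a8 b8; linarith [eta_lt hε hε2]) (by unfold a8; linarith), rL_eq]
  simp [beta7]

include hε2 in
/-- **U1 data**: `S₁ ≥ S₁(s₇) = 19/20 - tan β₇ / 5` and `S₁ < 3/2` on `[s₇, R]`. [folklore] -/
theorem U1_mem {r : ℝ} (h1 : s7 ε ≤ r) (h2 : r ≤ Rdisc ε) :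
    19 / 20 - Real.tan (beta7 ε) / 5 ≤ S1 hε hε2 r ∧ S1 hε hε2 r < 3 / 2 := by
  have hmono := strictMonoOn_posL hε hε2
  have hle : (fishTref ε hε hε2).posL (s7 ε) ≤ (fishTref ε hε hε2).posL r :=
    hmono.monotoneOn (by simp) (by show s7 ε - 3 / 100 < r; linarith) h1
  rw [posL_s7 hε hε2] at hle
  refine ⟨by rw [S1, bxH]; linarith, ?_⟩
  -- `L_c - 1/4 < posL r < L_c + 2` (as in `ldU1_ref`)
  have htan := tan_beta7_ge (ε := ε); have htan' := (tan_beta7_bounds ε).2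
  have hup : (fishTref ε hε hε2).posL r < Lc ε + 2 := by
    rw [fishTref_eq, posL_eq, blendFun]
    have hχ := stdBlend_mem (a8 ε) (b8 ε) r
    have hf : (fishTgen ε hε hε2 1 (Lc ε) fun _ ↦ (0:ℝ)).rL (angleDown (rone ε) r) = 1 * Lc ε - 1 / 4 - Real.tan (angleDown (rone ε) r) := rL_eq hε hε2 _
    rw [hf]
    have hr2 : r < Lc ε + 2 := by unfold Rdisc at h2; unfold Lc; linarith
    have hLr : Lc ε - 1 / 4 < r := by unfold Lc; linarith
    have hβle : angleDown (rone ε) r ≤ beta7 ε := (strictAnti_angleDown (rone ε)).antitone h1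
    have hβ7 := (beta7_bounds ε).2
    have htβ : Real.tan (angleDown (rone ε) r) < 0 := by
      have := Real.tan_lt_tan_of_lt_of_lt_pi_div_two (angleDown_mem _ _).1 (by linarith [Real.pi_pos]) (lt_of_le_of_lt hβle hβ7)
      rwa [Real.tan_zero] at this
    have hlow : Lc ε - 1 / 4 < 1 * Lc ε - 1 / 4 - Real.tan (angleDown (rone ε) r) := by linarith
    have hle' : angleDown (rone ε) (rone ε + 3) ≤ angleDown (rone ε) r := by
      refine (strictAnti_angleDown _).antitone ?_
      obtain ⟨hi1, hi2⟩ := inv_sqrt_three_bounds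
      unfold Rdisc s7 at h2; linarith
    have hval : angleDown (rone ε) (rone ε + 3) = -(π / 2) + 3 / 2 * Real.arctan 3⁻¹ := by
      rw [angleDown, add_sub_cancel_left, Real.arctan_inv_of_pos (by norm_num : (0:ℝ) < 3)]; ring
    have hA : 3 / 10 ≤ Real.arctan (3 : ℝ)⁻¹ := by
      have := div_one_add_sq_le_arctan (x := (3 : ℝ)⁻¹) (by norm_num)
      norm_num at this ⊢; linarith
    have hy0 : 0 < 3 / 2 * Real.arctan (3 : ℝ)⁻¹ := by linarith
    have hy2 : 3 / 2 * Real.arctan (3 : ℝ)⁻¹ < π / 2 := by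
      have := IwaseTori.arctan_le_self (x := (3 : ℝ)⁻¹) (by norm_num); norm_num at this; linarith [Real.pi_gt_three]
    have ht1 : Real.tan (angleDown (rone ε) (rone ε + 3)) ≤ Real.tan (angleDown (rone ε) r) := by
      rcases hle'.lt_or_eq with hlt | heq
      · exact (Real.tan_lt_tan_of_lt_of_lt_pi_div_two (angleDown_mem _ _).1 (by linarith [Real.pi_pos]) hlt).le
      · rw [heq]
    have ht2 : -(3 / 2 * Real.arctan (3 : ℝ)⁻¹)⁻¹ ≤ Real.tan (angleDown (rone ε) (rone ε + 3)) := by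
      rw [hval, show -(π / 2) + 3 / 2 * Real.arctan (3 : ℝ)⁻¹ = 3 / 2 * Real.arctan (3 : ℝ)⁻¹ - π / 2 by ring]
      exact neg_inv_le_tan_sub_pi_div_two hy0 hy2
    have ht3 : (3 / 2 * Real.arctan (3 : ℝ)⁻¹)⁻¹ ≤ 20 / 9 := by rw [inv_le_comm₀ hy0 (by norm_num)]; linarith
    have hhigh : 1 * Lc ε - 1 / 4 - Real.tan (angleDown (rone ε) r) < Lc ε + 2 := by linarith
    exact (convex_combo_mem_Ioo hχ.1 hχ.2 ⟨hlow, hhigh⟩ ⟨hLr, hr2⟩).2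
  rw [S1, bxH]; linarith

/-- **Ranges of the upper data**: `uY ∈ [-ρ_A, π - 1/20]`, `uS ∈ (1/2, 3/2)`, `uN ∈ (-ε, 0)`. [folklore] -/
theorem u_mem {r : ℝ} (h1 : s3 ε ≤ r) (h2 : r ≤ Rdisc ε) (ϑ : ℝ) :
    -ρA ≤ uY hε hε2 r ∧ uY hε hε2 r ≤ π - 1 / 20 ∧ 1 / 2 < uS hε hε2 r ϑ ∧ uS hε hε2 r ϑ < 3 / 2 ∧
      -ε < uN ε r ϑ ∧ uN ε r ϑ < 0 := by
  have hπ := Real.pi_gt_three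
  have hρ := ρA_pos; have hR := R0_pos
  obtain ⟨-, -, w34, w45, w56, w67, w6, -, wR⟩ := windows hε hε2
  have hnj1 := nj_neg ε hε; have hnj2 : -ε < nj ε := by rw [show nj ε = -(9 * ε / 10) from rfl]; linarith
  have htan := tan_beta7_ge (ε := ε); have htan' := (tan_beta7_bounds ε).2
  rw [uY, uS, uN]
  by_cases h4 : r < s4 ε
  · simp only [if_pos h4]
    obtain ⟨hX1, hX2, hY1, hY2⟩ := U5_mem hε hε2 h1 h4
    obtain ⟨-, -, hy3, -⟩ := U4_mem hε hε2 (r := s4 ε) le_rfl (by linarith)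
    have hw : ‖(X5 ε r : ℂ) * exp (ϑ * I)‖ ≤ 1 / 5 := by
      rw [norm_mul, Complex.norm_exp_ofReal_mul_I, mul_one, Complex.norm_real, Real.norm_eq_abs, abs_of_nonneg (by linarith)]
      unfold ρA at hX2; linarith
    obtain ⟨him, hne, -⟩ := d0_add_mem hε hw
    obtain ⟨hS1, hS2⟩ := capS_mem_of_im_neg him
    obtain ⟨hN1, hN2⟩ := capN_mem hε hne
    have := footY_le_footY hρ (by linarith [alpha_gt_pi_div_two (ε := ε) (r := s4 ε) (by linarith), Real.pi_pos]) ((strictMono_angleUp _).monotone (by linarith : s4 ε ≤ s5 ε)) (angleUp_mem _ _).2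
    refine ⟨hY1, by linarith, hS1, by rw [d5]; linarith, by rw [d5]; exact hN1, by rw [d5]; exact hN2⟩
  simp only [if_neg h4]
  by_cases h5 : r < s5 ε
  · simp only [if_pos h5]
    obtain ⟨hy1, hy2, hy3, hy0⟩ := U4_mem hε hε2 (not_lt.1 h4) h5
    have hu := uU_mem hρ (y4 ε r)
    have hw : ‖(uU ρA (y4 ε r) : ℂ) * exp (ϑ * I)‖ ≤ 1 / 5 := by
      rw [norm_mul, Complex.norm_exp_ofReal_mul_I, mul_one, Complex.norm_real, Real.norm_eq_abs, abs_of_nonneg hu.1]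
      have hρv : ρA = 1 / 20 := rfl
      linarith [hu.2]
    obtain ⟨him, hne, -⟩ := d0_add_mem hε hw
    obtain ⟨hS1, hS2⟩ := capS_mem_of_im_neg him
    obtain ⟨hN1, hN2⟩ := capN_mem hε hne
    refine ⟨by linarith, by linarith, hS1, by rw [d4]; linarith, by rw [d4]; exact hN1, by rw [d4]; exact hN2⟩
  simp only [if_neg h5]
  by_cases h6 : r < s6 ε
  · simp only [if_pos h6]
    obtain ⟨hy1, hy2, h6a, h6b⟩ := U3_mem hε hε2 (not_lt.1 h5) h6
    obtain ⟨-, -, -, hy0⟩ := U4_mem hε hε2 (r := s4 ε) le_rfl (by linarith)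
    have := footY_le_footY hρ (by linarith [alpha_gt_pi_div_two (ε := ε) (r := s4 ε) (by linarith), Real.pi_pos]) ((strictMono_angleUp _).monotone (by linarith : s4 ε ≤ s5 ε)) (angleUp_mem _ _).2
    refine ⟨by linarith, ?_, by norm_num, by norm_num, hnj2, hnj1⟩
    have hRv : R0 = 1 / 5 := rfl
    rw [cY] at hy2; linarith
  simp only [if_neg h6]
  by_cases h7 : r < s7 ε
  · simp only [if_pos h7]
    obtain ⟨hX1, hX2, hY1, hY2⟩ := U2_mem hε hε2 (not_lt.1 h6) h7
    obtain ⟨-, -, h6a, h6b⟩ := U3_mem hε hε2 (r := s5 ε) le_rfl (by linarith)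
    rw [cY]; unfold R0 at *
    refine ⟨by linarith, by linarith, by linarith, by linarith, hnj2, hnj1⟩
  · simp only [if_neg h7]
    obtain ⟨hS1, hS2⟩ := U1_mem hε hε2 (not_lt.1 h7) h2
    rw [cY]
    refine ⟨by linarith, by linarith, by linarith, hS2, hnj2, hnj1⟩

end Upper

/-! ### Equal physical points -/

section Physical

/-- **Equal physical points have equal data** (latitude and height on the circle, angle on the
circle, base exactly), for bases in `[1/2, 3/2)` and latitudes in `(-2π, 2π) ∖ {0}`. [folklore] -/
theorem uPt_eq_uPt {N Y ϑ S N' Y' ϑ' S' : ℝ} (hS : 1 / 2 ≤ S ∧ S < 3 / 2) (hS' : 1 / 2 ≤ S' ∧ S' < 3 / 2)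
    (hN : N ≠ 0 ∧ |N| < 2 * π) (hN' : N' ≠ 0 ∧ |N'| < 2 * π)
    (h : uPt hε hε2 N Y ϑ S = uPt hε hε2 N' Y' ϑ' S') :
    Circle.exp N = Circle.exp N' ∧ Circle.exp Y = Circle.exp Y' ∧ Circle.exp ϑ = Circle.exp ϑ' ∧ S = S' := by
  have hmem : ∀ {N Y ϑ S : ℝ}, 1 / 2 ≤ S ∧ S < 3 / 2 → N ≠ 0 ∧ |N| < 2 * π →
      mtCoord tubeShearDiffeo (WithLp.toLp 2 ![N - ϑ, Y, ϑ], S) ∈ (fishNu hε hε2).complement := by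
    intro N Y ϑ S hS hN
    refine mtPt_mem_complement_of_latC hε hε2 (by linarith [hS.1]) hS.2 ?_
    rw [← mtCoord, latC_mtCoord (q := (WithLp.toLp 2 ![N - ϑ, Y, ϑ], S)) (by linarith [hS.1]) hS.2]
    simp only [show (WithLp.toLp 2 ![N - ϑ, Y, ϑ] : 𝔼 3) 0 + (WithLp.toLp 2 ![N - ϑ, Y, ϑ] : 𝔼 3) 2 = N by simp]
    exact circleExp_ne_one hN.1 hN.2
  have h1 := toSurg_inj (hmem hS hN) (hmem hS' hN') h
  rw [mtCoord, mtCoord] at h1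
  obtain ⟨hx, hs⟩ := mtPt_inj_Ico (by exact ⟨hS.1, hS.2⟩) (by exact ⟨hS'.1, hS'.2⟩) h1
  have e1 := congrArg (fun x : ThreeTorus ↦ x.1) hx
  have e2 := congrArg (fun x : ThreeTorus ↦ x.2.1) hx
  have e3 := congrArg (fun x : ThreeTorus ↦ x.2.2) hx
  simp only [expT] at e1 e2 e3
  simp at e1 e2 e3
  refine ⟨?_, e2, e3, hs⟩
  have h4 : Circle.exp (N - ϑ) = Circle.exp (N' - ϑ') := by simpa [Circle.exp_sub] using e1
  calc Circle.exp N = Circle.exp (N - ϑ) * Circle.exp ϑ := by rw [← Circle.exp_add, sub_add_cancel]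
    _ = Circle.exp (N' - ϑ') * Circle.exp ϑ' := by rw [h4, e3]
    _ = Circle.exp N' := by rw [← Circle.exp_add, sub_add_cancel]

end Physical

/-! ### Injectivity within the upper pieces -/

section UpperInj

/-- When `Y₂ = 0` on the U2 window the point is of flat type: `X₂ = u₀(β)`, `β < π/2`. [folklore] -/
theorem X2_of_Y2_zero {r : ℝ} (h1 : s6 ε - 1 / 10 < r) (h2 : r < s7 ε + 1 / 10) (hY : Y2 ε r = 0) :
    X2 ε r = flatU R0 (angleDown (rone ε) r) ∧ angleDown (rone ε) r < π / 2 := by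
  have hπ := Real.pi_pos
  have hρ := R0_pos
  have hah := arctan_half_lt_pi_div_six
  have hA2 := pi_div_three_lt_arctan_two
  obtain ⟨hβ1, hβ2⟩ := beta_winU2 (ε := ε) (r := r) h1 h2
  set β := angleDown (rone ε) r with hβ
  rcases lt_or_ge β (π / 6) with hlt | hge
  · rw [X2, pathShell_zero_flat hρ hlt]; exact ⟨rfl, by linarith⟩
  rcases le_or_gt β (π / 2) with hle | hgt
  · rw [Y2, pathShell_zero_bend hρ (by linarith) (by linarith [Real.arctan_lt_pi_div_two (2:ℝ)])] at hY
    simp only at hY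
    have hc : Real.cos β ≠ 0 := by
      intro hc; rw [hc, mul_zero, sub_zero] at hY; exact hρ.ne' hY
    have hβlt : β < π / 2 := lt_of_le_of_ne hle fun h ↦ hc (by rw [h, Real.cos_pi_div_two])
    refine ⟨?_, hβlt⟩
    rw [X2, pathShell_zero_bend hρ (by linarith) (by linarith [Real.arctan_lt_pi_div_two (2:ℝ)]), flatU]
    simp only
    have hR : bendR R0 β = R0 / Real.cos β := by field_simp; linarith
    rw [hR, Real.tan_eq_sin_div_cos]; field_simp
    simp only [hβ]
  · exfalso
    rw [Y2, snd_pathShell_zero_eq hρ hgt, footY] at hY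
    have hs : 0 < Real.sin β := Real.sin_pos_of_pos_of_lt_pi (by linarith) (angleDown_mem _ _).2
    have hc : Real.cos β < 0 := Real.cos_neg_of_pi_div_two_lt_of_lt hgt (by linarith [(angleDown_mem (rone ε) r).2])
    have : Real.cos β / Real.sin β < 0 := div_neg_of_neg_of_pos hc hs
    nlinarith

include hε hε2 in
/-- **A U2 point at height `c_Y` has base below every U1 base.** [folklore] -/
theorem uS_U2_lt {r : ℝ} (h1 : s6 ε ≤ r) (h2 : r < s7 ε) (hY : Y2 ε r = 0) :
    3 / 4 - 2 * R0 + X2 ε r < 19 / 20 - Real.tan (beta7 ε) / 5 := by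
  obtain ⟨hX, hβ⟩ := X2_of_Y2_zero (ε := ε) (by linarith) (by linarith) hY
  have hβ7 : beta7 ε < angleDown (rone ε) r := strictAnti_angleDown _ h2
  have ht : Real.tan (beta7 ε) < Real.tan (angleDown (rone ε) r) :=
    Real.tan_lt_tan_of_lt_of_lt_pi_div_two (by linarith [(beta7_bounds ε).1, Real.pi_pos]) hβ hβ7
  rw [hX, flatU, R0]; linarith

include hε hε2 in
/-- **Injectivity of the upper data**: equal height, base and latitude (on the circle) at the
same angle force equal radii. [folklore] -/
theorem upper_inj {r r' ϑ : ℝ} (hr : s3 ε ≤ r ∧ r ≤ Rdisc ε) (hr' : s3 ε ≤ r' ∧ r' ≤ Rdisc ε)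
    (hY : uY hε hε2 r = uY hε hε2 r') (hS : uS hε hε2 r ϑ = uS hε hε2 r' ϑ) (hN : uN ε r ϑ = uN ε r' ϑ) : r = r' := by
  have hπ := Real.pi_gt_three
  have hρ := ρA_pos; have hR := R0_pos
  obtain ⟨-, -, w34, w45, w56, w67, w6, -, wR⟩ := windows hε hε2
  -- symmetric roles: reduce to `r ≤ r'`
  wlog hle : r ≤ r' generalizing r r'
  · exact (this hr' hr hY.symm hS.symm hN.symm (le_of_not_ge hle)).symm
  obtain ⟨h3, hR1⟩ := hr; obtain ⟨h3', hR1'⟩ := hr'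
  -- thresholds of the heights
  obtain ⟨-, -, hy53, hy40⟩ := U4_mem hε hε2 (r := s4 ε) le_rfl (by linarith)
  have hy45 : footY ρA (angleUp (rzero ε) (s4 ε)) ≤ footY ρA (angleUp (rzero ε) (s5 ε)) :=
    footY_le_footY hρ (by linarith [alpha_gt_pi_div_two (ε := ε) (r := s4 ε) (by linarith), Real.pi_pos])
      ((strictMono_angleUp _).monotone (by linarith : s4 ε ≤ s5 ε)) (angleUp_mem _ _).2
  obtain ⟨-, -, h6a, h6b⟩ := U3_mem hε hε2 (r := s5 ε) le_rfl (by linarith)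
  have hcY : cY = π - 1 / 4 := rfl
  have hRv : R0 = 1 / 5 := rfl
  rw [uY, uY] at hY; rw [uS, uS] at hS; rw [uN, uN] at hN
  by_cases h4' : r' < s4 ε
  · -- both in U5
    have h4 : r < s4 ε := by linarith
    simp only [if_pos h4, if_pos h4'] at hY hS hN
    obtain ⟨hX1, hX2, -, -⟩ := U5_mem hε hε2 h3 h4
    obtain ⟨hX1', hX2', -, -⟩ := U5_mem hε hε2 h3' h4'
    have hw : ‖(X5 ε r : ℂ) * exp (ϑ * I)‖ ≤ 1 / 5 := by
      rw [norm_mul, Complex.norm_exp_ofReal_mul_I, mul_one, Complex.norm_real, Real.norm_eq_abs, abs_of_nonneg (by linarith)]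
      have : ρA = 1 / 20 := rfl
      linarith
    have hw' : ‖(X5 ε r' : ℂ) * exp (ϑ * I)‖ ≤ 1 / 5 := by
      rw [norm_mul, Complex.norm_exp_ofReal_mul_I, mul_one, Complex.norm_real, Real.norm_eq_abs, abs_of_nonneg (by linarith)]
      have : ρA = 1 / 20 := rfl
      linarith
    obtain ⟨him, hne, -⟩ := d0_add_mem hε hw
    obtain ⟨him', hne', -⟩ := d0_add_mem hε hw'
    have hd : d5 ε r ϑ = d5 ε r' ϑ := by
      refine eq_of_capN_eq_arg_eq hε hN ?_
      have := hS; rw [capS, capS] at this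
      field_simp at this; linarith
    have hX : X5 ε r = X5 ε r' := by
      rw [d5, d5, add_right_inj] at hd
      have := mul_right_cancel₀ (Complex.exp_ne_zero _) hd
      exact_mod_cast this
    -- the planar path is injective at zero offset
    obtain ⟨δ, hδ, hinj⟩ := exists_injOn_pathShell ρA_pos
    obtain ⟨hα1, hα2⟩ := alpha_winU5 (ε := ε) (r := r) (by linarith) (by linarith)
    obtain ⟨hα1', hα2'⟩ := alpha_winU5 (ε := ε) (r := r') (by linarith) (by linarith)
    have h13 : Real.arctan (1 / 3) < π / 4 := by
      have := Real.arctan_strictMono (show (1:ℝ) / 3 < 1 by norm_num); rwa [Real.arctan_one] at this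
    have key := hinj (show (angleUp (rzero ε) r, (0:ℝ)) ∈ Icc (-(π / 4)) (π - Real.arctan (1 / 3)) ×ˢ Ioo (-δ) δ from
      ⟨⟨hα1.le, by linarith⟩, by simp [hδ]⟩)
      (show (angleUp (rzero ε) r', (0:ℝ)) ∈ Icc (-(π / 4)) (π - Real.arctan (1 / 3)) ×ˢ Ioo (-δ) δ from
      ⟨⟨hα1'.le, by linarith⟩, by simp [hδ]⟩)
      (Prod.ext (by exact hX) (by exact hY))
    exact (strictMono_angleUp _).injective (Prod.ext_iff.1 key).1
  simp only [if_neg h4'] at hY hS hN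
  by_cases h5' : r' < s5 ε
  · simp only [if_pos h5'] at hY hS hN
    obtain ⟨hy1', hy2', -, -⟩ := U4_mem hε hε2 (not_lt.1 h4') h5'
    by_cases h4 : r < s4 ε
    · exfalso
      simp only [if_pos h4] at hY
      obtain ⟨-, -, -, hY2⟩ := U5_mem hε hε2 h3 h4
      linarith
    simp only [if_neg h4, if_pos (lt_of_le_of_lt hle h5')] at hY
    -- both in U4: `y(α r) = y(α r')`
    have hαr := alpha_gt_pi_div_two (ε := ε) (r := r) (by linarith)
    have hαr' := alpha_gt_pi_div_two (ε := ε) (r := r') (by linarith)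
    have key := (strictMonoOn_footY hρ).injOn ⟨by linarith, (angleUp_mem _ r).2⟩ ⟨by linarith, (angleUp_mem _ r').2⟩ hY
    exact (strictMono_angleUp _).injective key
  simp only [if_neg h5'] at hY hS hN
  by_cases h6' : r' < s6 ε
  · simp only [if_pos h6'] at hY hS
    obtain ⟨hy1', hy2', -, -⟩ := U3_mem hε hε2 (not_lt.1 h5') h6'
    by_cases h4 : r < s4 ε
    · exfalso; simp only [if_pos h4] at hY
      obtain ⟨-, -, -, hY2⟩ := U5_mem hε hε2 h3 h4; linarith
    simp only [if_neg h4] at hY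
    by_cases h5 : r < s5 ε
    · exfalso; simp only [if_pos h5] at hY
      obtain ⟨-, hy2, -, -⟩ := U4_mem hε hε2 (not_lt.1 h4) h5; linarith
    simp only [if_neg h5, if_pos (lt_of_le_of_lt hle h6')] at hY
    exact (strictMonoOn_yfun hε hε2).injOn ⟨by linarith, by linarith⟩ ⟨by linarith, by linarith⟩ hY
  simp only [if_neg h6'] at hY hS hN
  by_cases h7' : r' < s7 ε
  · simp only [if_pos h7'] at hY hS
    obtain ⟨hX1', hX2', hY1', hY2'⟩ := U2_mem hε hε2 (not_lt.1 h6') h7'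
    by_cases h4 : r < s4 ε
    · exfalso; simp only [if_pos h4] at hY
      obtain ⟨-, -, -, hY2⟩ := U5_mem hε hε2 h3 h4; linarith
    simp only [if_neg h4] at hY hS
    by_cases h5 : r < s5 ε
    · exfalso; simp only [if_pos h5] at hY
      obtain ⟨-, hy2, -, -⟩ := U4_mem hε hε2 (not_lt.1 h4) h5; linarith
    simp only [if_neg h5] at hY hS
    by_cases h6 : r < s6 ε
    · exfalso; simp only [if_pos h6] at hY
      obtain ⟨-, hy2, -, -⟩ := U3_mem hε hε2 (not_lt.1 h5) h6; linarith
    simp only [if_neg h6, if_pos (lt_of_le_of_lt hle h7')] at hY hS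
    -- both in U2: the planar path at `R₀` is injective at zero offset
    have hYY : Y2 ε r = Y2 ε r' := by linarith
    have hXX : X2 ε r = X2 ε r' := by linarith
    obtain ⟨δ, hδ, hinj⟩ := exists_injOn_pathShell R0_pos
    obtain ⟨hβ1, hβ2⟩ := beta_winU2 (ε := ε) (r := r) (by linarith) (by linarith)
    obtain ⟨hβ1', hβ2'⟩ := beta_winU2 (ε := ε) (r := r') (by linarith) (by linarith)
    have key := hinj (show (angleDown (rone ε) r, (0:ℝ)) ∈ Icc (-(π / 4)) (π - Real.arctan (1 / 3)) ×ˢ Ioo (-δ) δ from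
      ⟨⟨hβ1.le, hβ2⟩, by simp [hδ]⟩)
      (show (angleDown (rone ε) r', (0:ℝ)) ∈ Icc (-(π / 4)) (π - Real.arctan (1 / 3)) ×ˢ Ioo (-δ) δ from
      ⟨⟨hβ1'.le, hβ2'⟩, by simp [hδ]⟩)
      (Prod.ext (by exact hXX) (by exact hYY))
    exact (strictAnti_angleDown _).injective (Prod.ext_iff.1 key).1
  -- `r'` in U1
  simp only [if_neg h7'] at hY hS
  obtain ⟨hS1', -⟩ := U1_mem hε hε2 (not_lt.1 h7') hR1'
  by_cases h4 : r < s4 ε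
  · exfalso; simp only [if_pos h4] at hY
    obtain ⟨-, -, -, hY2⟩ := U5_mem hε hε2 h3 h4; linarith
  simp only [if_neg h4] at hY hS
  by_cases h5 : r < s5 ε
  · exfalso; simp only [if_pos h5] at hY
    obtain ⟨-, hy2, -, -⟩ := U4_mem hε hε2 (not_lt.1 h4) h5; linarith
  simp only [if_neg h5] at hY hS
  by_cases h6 : r < s6 ε
  · exfalso; simp only [if_pos h6] at hY
    obtain ⟨-, hy2, -, -⟩ := U3_mem hε hε2 (not_lt.1 h5) h6; linarith
  simp only [if_neg h6] at hY hS
  by_cases h7 : r < s7 ε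
  · exfalso; simp only [if_pos h7] at hY hS
    have hY0 : Y2 ε r = 0 := by linarith
    have := uS_U2_lt hε hε2 (not_lt.1 h6) h7 hY0
    linarith
  simp only [if_neg h7] at hS
  rw [S1, S1] at hS
  have hp : (fishTref ε hε hε2).posL r = (fishTref ε hε hε2).posL r' := by
    have := hS; rw [bxH] at this; linarith
  exact (strictMonoOn_posL hε hε2).injOn (show s7 ε - 3 / 100 < r by linarith) (show s7 ε - 3 / 100 < r' by linarith) hp

include hε hε2 in
/-- **Zero height happens only on U5.** [folklore] -/
theorem lt_s4_of_uY_zero {r : ℝ} (hY : uY hε hε2 r = 0) : r < s4 ε := by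
  have hπ := Real.pi_gt_three
  have hρ := ρA_pos
  obtain ⟨-, -, w34, w45, w56, w67, w6, -, wR⟩ := windows hε hε2
  obtain ⟨-, -, hy53, hy40⟩ := U4_mem hε hε2 (r := s4 ε) le_rfl (by linarith)
  have hy45 : footY ρA (angleUp (rzero ε) (s4 ε)) ≤ footY ρA (angleUp (rzero ε) (s5 ε)) :=
    footY_le_footY hρ (by linarith [alpha_gt_pi_div_two (ε := ε) (r := s4 ε) (by linarith), Real.pi_pos])
      ((strictMono_angleUp _).monotone (by linarith : s4 ε ≤ s5 ε)) (angleUp_mem _ _).2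
  obtain ⟨-, -, h6a, h6b⟩ := U3_mem hε hε2 (r := s5 ε) le_rfl (by linarith)
  have hcY : cY = π - 1 / 4 := rfl
  have hRv : R0 = 1 / 5 := rfl
  by_contra h4
  rw [uY, if_neg h4] at hY
  by_cases h5 : r < s5 ε
  · rw [if_pos h5] at hY; obtain ⟨hy1, -⟩ := U4_mem hε hε2 (not_lt.1 h4) h5; linarith
  rw [if_neg h5] at hY
  by_cases h6 : r < s6 ε
  · rw [if_pos h6] at hY; obtain ⟨hy1, -⟩ := U3_mem hε hε2 (not_lt.1 h5) h6; linarith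
  rw [if_neg h6] at hY
  by_cases h7 : r < s7 ε
  · rw [if_pos h7] at hY; obtain ⟨-, -, -, hY2⟩ := U2_mem hε hε2 (not_lt.1 h6) h7; linarith
  · rw [if_neg h7] at hY; linarith

end UpperInj

/-! ### The north chart data -/

section North

include hε2 in
/-- **North latitudes lie in `[L₂ - 2π, 0)`.** [folklore] -/
theorem capN_dN_mem {ζ : ℂ} (h1 : s2 ε ≤ ‖ζ‖) (h2 : ‖ζ‖ < s3 ε) (hd : dN hε hε2 ζ ≠ 0) :
    L2 ε - 2 * π ≤ capN ε (dN hε hε2 ζ) ∧ capN ε (dN hε hε2 ζ) < 0 ∧ -ε < capN ε (dN hε hε2 ζ) := by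
  obtain ⟨h23, h3⟩ := s2_lt_s3 hε hε2
  obtain ⟨hs1, -⟩ := s2_bounds hε hε2
  set T := fishTref ε hε hε2 with hT
  obtain ⟨hcap, hP0⟩ := capLat_Pfun hε hε2 h1 (by linarith)
  obtain ⟨hN1, hN2⟩ := capN_mem hε hd
  refine ⟨?_, hN2, hN1⟩
  have hnorm : ‖((T.Pfun ‖ζ‖ : ℝ) : ℂ) * exp (arg ζ * I)‖ = T.Pfun ‖ζ‖ := by
    rw [norm_mul, Complex.norm_exp_ofReal_mul_I, mul_one, Complex.norm_real, Real.norm_eq_abs, abs_of_pos hP0]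
  by_cases hP : Rtwo ≤ T.Pfun ‖ζ‖
  · have hd_eq : dN hε hε2 ζ = ((T.Pfun ‖ζ‖ : ℝ) : ℂ) * exp (arg ζ * I) := by
      rw [dN, TubeDData.tdisc, transDisc_of_le_norm T.hC T.hR₁ T.hR₁₂ T.hroom (by rw [hnorm]; exact hP)]
    rw [hd_eq, capN, hnorm, hcap, ← nfun_s2 hε hε2]
    have := (strictMonoOn_nfun hε hε2 (c := 1) (ρb := Lc ε) (μ := fun _ ↦ 0)).monotoneOn ⟨by linarith, by linarith⟩ ⟨by linarith, by linarith⟩ h1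
    rw [← fishTref_eq] at this; linarith
  · refine capN_ge_of_norm_le hε ((norm_tdisc_le T _).trans ?_)
    rw [hnorm, show T.ε = ε from rfl, show T.nj = nj ε from rfl, norm_capD0 (nj_sq_lt ε hε) (nj_neg ε hε)]
    linarith [(capTj_bounds (ε := ε) hε).2, not_le.1 hP]

include hε2 in
/-- **Injectivity of the north chart datum.** [folklore] -/
theorem dN_inj {ζ ζ' : ℂ} (h1 : s2 ε ≤ ‖ζ‖) (h2 : ‖ζ‖ < s3 ε) (h1' : s2 ε ≤ ‖ζ'‖) (h2' : ‖ζ'‖ < s3 ε)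
    (h : dN hε hε2 ζ = dN hε hε2 ζ') : ζ = ζ' := by
  obtain ⟨h23, h3⟩ := s2_lt_s3 hε hε2
  set T := fishTref ε hε hε2 with hT
  rw [dN, dN] at h
  have h' := T.tdisc.injective h
  obtain ⟨-, hP0⟩ := capLat_Pfun hε hε2 h1 (by linarith)
  obtain ⟨-, hP0'⟩ := capLat_Pfun hε hε2 h1' (by linarith)
  have hn := congrArg (fun z : ℂ ↦ ‖z‖) h'
  simp only [norm_mul, Complex.norm_exp_ofReal_mul_I, mul_one, Complex.norm_real, Real.norm_eq_abs, abs_of_pos hP0, abs_of_pos hP0'] at hn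
  have hrr : ‖ζ‖ = ‖ζ'‖ := Pfun_inj hε hε2 h1 (by linarith) h1' (by linarith) hn
  rw [hrr] at h'
  have he := mul_left_cancel₀ (by exact_mod_cast hP0'.ne' : ((T.Pfun ‖ζ'‖ : ℝ) : ℂ) ≠ 0) h'
  rw [← norm_mul_exp_arg_mul_I ζ, ← norm_mul_exp_arg_mul_I ζ', hrr, he]

include hε2 in
/-- **A north chart point is never an upper chart point** (`P > u₀(α(s₃)) ≥ X₅`). [folklore] -/
theorem dN_ne_d5 {ζ : ℂ} (h1 : s2 ε ≤ ‖ζ‖) (h2 : ‖ζ‖ < s3 ε) {r ϑ : ℝ} (hr1 : s3 ε ≤ r) (hr2 : r < s4 ε) :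
    dN hε hε2 ζ ≠ d5 ε r ϑ := by
  intro h
  obtain ⟨h23, h3⟩ := s2_lt_s3 hε hε2
  obtain ⟨-, -, w34, -⟩ := windows hε hε2
  set T := fishTref ε hε hε2 with hT
  obtain ⟨hX1, hX2, -, -⟩ := U5_mem hε hε2 hr1 hr2
  have hρ := ρA_pos
  have hw : ‖(X5 ε r : ℂ) * exp (ϑ * I)‖ = X5 ε r := by
    rw [norm_mul, Complex.norm_exp_ofReal_mul_I, mul_one, Complex.norm_real, Real.norm_eq_abs, abs_of_nonneg (by linarith)]
  have hd5 : d5 ε r ϑ = T.tdisc ((X5 ε r : ℂ) * exp (ϑ * I)) := by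
    rw [d5, TubeDData.tdisc, transDisc_of_norm_le T.hC T.hR₁ T.hR₁₂ T.hroom
      (by rw [hw]; show X5 ε r ≤ Rone; unfold Rone; unfold ρA at hX2; linarith), add_comm]; rfl
  rw [hd5, dN] at h
  have h' := T.tdisc.injective h
  obtain ⟨-, hP0⟩ := capLat_Pfun hε hε2 h1 (by linarith)
  have hn := congrArg (fun z : ℂ ↦ ‖z‖) h'
  simp only [norm_mul, Complex.norm_exp_ofReal_mul_I, mul_one, Complex.norm_real, Real.norm_eq_abs, abs_of_pos hP0,
    abs_of_nonneg (show 0 ≤ X5 ε r by linarith)] at hn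
  have hlt := flatU_s3_lt_Pfun hε hε2 h1 h2
  have hle := fst_pathShell_alpha_le (ε := ε) hr1 (by linarith)
  rw [← X5] at hle
  linarith

end North

/-! ### Classification and injectivity -/

section Main

include hε2 in
/-- **Classification of the points of the reference disc.** [folklore] -/
theorem classify {ζ : ℂ} (h : ‖ζ‖ ≤ Rdisc ε) :
    (ζ = 0 ∧ discRef hε hε2 ζ = capEnd (fishNu hε hε2) 1 (0, 0, 0)) ∨
    (0 < ‖ζ‖ ∧ ‖ζ‖ < s2 ε ∧ OldPt hε hε2 (discRef hε hε2 ζ) ((fishTref ε hε hε2).nfun ‖ζ‖) 0 (arg ζ)) ∨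
    (s2 ε ≤ ‖ζ‖ ∧ ‖ζ‖ < s3 ε ∧ dN hε hε2 ζ = 0 ∧ discRef hε hε2 ζ = capEndN (fishNu hε hε2) 1 (0, 0, 0)) ∨
    (s2 ε ≤ ‖ζ‖ ∧ ‖ζ‖ < s3 ε ∧ dN hε hε2 ζ ≠ 0 ∧
      OldPt hε hε2 (discRef hε hε2 ζ) (capN ε (dN hε hε2 ζ)) 0 (arg (dN hε hε2 ζ))) ∨
    (s3 ε ≤ ‖ζ‖ ∧ discRef hε hε2 ζ = uPt hε hε2 (uN ε ‖ζ‖ (arg ζ)) (uY hε hε2 ‖ζ‖) (arg ζ) (uS hε hε2 ‖ζ‖ (arg ζ)) ∧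
      OldPt hε hε2 (discRef hε hε2 ζ) (uN ε ‖ζ‖ (arg ζ)) (uY hε hε2 ‖ζ‖) (2 * π * uS hε hε2 ‖ζ‖ (arg ζ))) := by
  have hπ := Real.pi_gt_three
  obtain ⟨w12, w23, -⟩ := windows hε hε2
  by_cases h0 : ζ = 0
  · left; refine ⟨h0, ?_⟩
    rw [h0, discRef_S hε hε2 (by rw [norm_zero]; norm_num), winS_zero_centre]
  have hr0 : 0 < ‖ζ‖ := norm_pos_iff.2 h0
  right
  by_cases h2 : ‖ζ‖ < s2 ε
  · left; refine ⟨hr0, h2, ?_⟩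
    by_cases h1 : ‖ζ‖ < 3 / 4
    · rw [discRef_S hε hε2 h1]; exact oldPt_winS hε hε2 h0 (by linarith)
    · obtain ⟨hn1, hn2⟩ := nfun_mem_SA hε hε2 hr0 h2
      rw [discRef_A hε hε2 (not_lt.1 h1) h2]
      exact oldPt_winA hε hε2 hn1 (by linarith [(L2_bounds hε hε2).2])
  right
  by_cases h3 : ‖ζ‖ < s3 ε
  · by_cases hd : dN hε hε2 ζ = 0
    · left; refine ⟨not_lt.1 h2, h3, hd, ?_⟩
      rw [discRef_N hε hε2 (not_lt.1 h2) h3, winN_zero_centre hε hε2 hd]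
    · right; left; refine ⟨not_lt.1 h2, h3, hd, ?_⟩
      rw [discRef_N hε hε2 (not_lt.1 h2) h3]; exact oldPt_winN hε hε2 hd
  · right; right
    have h3' := not_lt.1 h3
    obtain ⟨-, -, hS1, hS2, hN1, hN2⟩ := u_mem hε hε2 h3' h (arg ζ)
    refine ⟨h3', discRef_U hε hε2 h3', ?_⟩
    rw [discRef_U hε hε2 h3']
    exact oldPt_uPt hε hε2 (by linarith) hS2 hN2.ne (by rw [abs_of_neg hN2]; linarith [hε2])

/-- `arg` is determined by its point on the circle. [folklore] -/
theorem arg_eq_of_circleExp_eq {ζ ζ' : ℂ} (h : Circle.exp (arg ζ) = Circle.exp (arg ζ')) : arg ζ = arg ζ' :=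
  eq_of_circleExp_eq h (by
    have := Complex.arg_le_pi ζ; have := Complex.neg_pi_lt_arg ζ
    have := Complex.arg_le_pi ζ'; have := Complex.neg_pi_lt_arg ζ'
    rw [abs_lt]; constructor <;> linarith)

include hε2 in
/-- **Gompf's disc is embedded: the reference disc is injective on `‖ζ‖ ≤ R`.** [cite: GompfAGT2010, Lemma 2.2 (proof: the disc D is embedded)] -/
theorem injOn_discRef : InjOn (discRef hε hε2) (Metric.closedBall (0 : ℂ) (Rdisc ε)) := by
  intro ζ hζ ζ' hζ' heq
  rw [Metric.mem_closedBall, dist_zero_right] at hζ hζ'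
  have hπ := Real.pi_gt_three
  have hL := L2_bounds hε hε2
  obtain ⟨-, w23, w34, -, -, -, -, -, wR⟩ := windows hε hε2
  obtain ⟨-, w3r⟩ := s2_lt_s3 hε hε2
  -- a south/annulus latitude never matches a north/upper-chart latitude on the circle
  have latSep : ∀ {a b : ℝ}, 0 < a → a < L2 ε → L2 ε - 2 * π ≤ b → b < 0 → Circle.exp a ≠ Circle.exp b := by
    intro a b ha1 ha2 hb1 hb2 hab
    have := eq_of_circleExp_eq hab (by rw [abs_lt]; constructor <;> linarith)
    linarith
  -- an upper point of height `0` on the circle is a U5 point; its latitude is a chart latitude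
  have upZero : ∀ {ξ : ℂ}, s3 ε ≤ ‖ξ‖ → ‖ξ‖ ≤ Rdisc ε → Circle.exp (uY hε hε2 ‖ξ‖) = Circle.exp 0 →
      ‖ξ‖ < s4 ε ∧ uY hε hε2 ‖ξ‖ = 0 := by
    intro ξ h3 hR h0
    obtain ⟨hY1, hY2, -⟩ := u_mem hε hε2 h3 hR (arg ξ)
    have hY : uY hε hε2 ‖ξ‖ = 0 := eq_of_circleExp_eq h0 (by
      have := ρA_pos; have : ρA = 1 / 20 := rfl
      rw [sub_zero, abs_lt]; constructor <;> linarith)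
    exact ⟨lt_s4_of_uY_zero hε hε2 hY, hY⟩
  have d5norm : ∀ {r ϑ : ℝ}, s3 ε ≤ r → r < s4 ε → ‖d5 ε r ϑ‖ ≤ Rtwo + 21 / 10 ∧ (d5 ε r ϑ).im < 0 := by
    intro r ϑ h3 h4
    obtain ⟨hX1, hX2, -, -⟩ := U5_mem hε hε2 h3 h4
    have hw : ‖(X5 ε r : ℂ) * exp (ϑ * I)‖ ≤ 1 / 5 := by
      rw [norm_mul, Complex.norm_exp_ofReal_mul_I, mul_one, Complex.norm_real, Real.norm_eq_abs, abs_of_nonneg (by linarith [ρA_pos])]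
      have : ρA = 1 / 20 := rfl
      linarith
    obtain ⟨him, -, hn⟩ := d0_add_mem hε hw
    exact ⟨by rw [d5]; linarith [Rtwo_ge], him⟩
  rcases classify hε hε2 hζ with ⟨hz, hD⟩ | ⟨hr0, hr2, hO⟩ | ⟨hr2, hr3, hd0, hD⟩ | ⟨hr2, hr3, hd0, hO⟩ | ⟨hr3, hU, hO⟩ <;>
    rcases classify hε hε2 hζ' with ⟨hz', hD'⟩ | ⟨hr0', hr2', hO'⟩ | ⟨hr2', hr3', hd0', hD'⟩ | ⟨hr2', hr3', hd0', hO'⟩ | ⟨hr3', hU', hO'⟩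
  -- ζ = 0
  · rw [hz, hz']
  · obtain ⟨m, -, hm, -⟩ := hO'; exact absurd (hm.symm.trans (heq.symm.trans hD)) (toSurg_ne_capEnd_zero hε hε2 m 1 0 0)
  · exact absurd (hD.symm.trans (heq.trans hD')) (capEnd_zero_ne_capEndN_zero hε hε2 1)
  · obtain ⟨m, -, hm, -⟩ := hO'; exact absurd (hm.symm.trans (heq.symm.trans hD)) (toSurg_ne_capEnd_zero hε hε2 m 1 0 0)
  · obtain ⟨m, -, hm, -⟩ := hO'; exact absurd (hm.symm.trans (heq.symm.trans hD)) (toSurg_ne_capEnd_zero hε hε2 m 1 0 0)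
  -- ζ south/annulus
  · obtain ⟨m, -, hm, -⟩ := hO; exact absurd (hm.symm.trans (heq.trans hD')) (toSurg_ne_capEnd_zero hε hε2 m 1 0 0)
  · rw [heq] at hO
    obtain ⟨hl, -, hb⟩ := hO.inv_eq hO'
    obtain ⟨hn1, hn2⟩ := nfun_mem_SA hε hε2 hr0 hr2
    obtain ⟨hn1', hn2'⟩ := nfun_mem_SA hε hε2 hr0' hr2'
    have hn := eq_of_circleExp_eq hl (by rw [abs_lt]; constructor <;> linarith)
    have hrr := nfun_inj hε hε2 hr0 (by linarith) hr0' (by linarith) hn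
    rw [← norm_mul_exp_arg_mul_I ζ, ← norm_mul_exp_arg_mul_I ζ', hrr, arg_eq_of_circleExp_eq hb]
  · obtain ⟨m, -, hm, -⟩ := hO; exact absurd (hm.symm.trans (heq.trans hD')) (toSurg_ne_capEndN_zero hε hε2 m 1 0 0)
  · exfalso
    rw [heq] at hO
    obtain ⟨hl, -⟩ := hO.inv_eq hO'
    obtain ⟨hn1, hn2⟩ := nfun_mem_SA hε hε2 hr0 hr2
    obtain ⟨hb1, hb2, -⟩ := capN_dN_mem hε hε2 hr2' hr3' hd0'
    exact latSep hn1 hn2 hb1 hb2 hl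
  · exfalso
    rw [heq] at hO
    obtain ⟨hl, hy, -⟩ := hO.inv_eq hO'
    obtain ⟨h4', hY0⟩ := upZero hr3' hζ' hy.symm
    obtain ⟨hn1, hn2⟩ := nfun_mem_SA hε hε2 hr0 hr2
    rw [uN, if_pos h4'] at hl
    obtain ⟨hdn, hdi⟩ := d5norm hr3' h4'
    have hne : d5 ε ‖ζ'‖ (arg ζ') ≠ 0 := fun h0 ↦ by rw [h0] at hdi; simp at hdi
    exact latSep hn1 hn2 (capN_ge_of_norm_le hε hdn) (capN_mem hε hne).2 hl
  -- ζ north, new point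
  · exact absurd (hD'.symm.trans (heq.symm.trans hD)) (capEnd_zero_ne_capEndN_zero hε hε2 1)
  · obtain ⟨m, -, hm, -⟩ := hO'; exact absurd (hm.symm.trans (heq.symm.trans hD)) (toSurg_ne_capEndN_zero hε hε2 m 1 0 0)
  · exact dN_inj hε hε2 hr2 hr3 hr2' hr3' (hd0.trans hd0'.symm)
  · obtain ⟨m, -, hm, -⟩ := hO'; exact absurd (hm.symm.trans (heq.symm.trans hD)) (toSurg_ne_capEndN_zero hε hε2 m 1 0 0)
  · obtain ⟨m, -, hm, -⟩ := hO'; exact absurd (hm.symm.trans (heq.symm.trans hD)) (toSurg_ne_capEndN_zero hε hε2 m 1 0 0)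
  -- ζ north, old point
  · obtain ⟨m, -, hm, -⟩ := hO; exact absurd (hm.symm.trans (heq.trans hD')) (toSurg_ne_capEnd_zero hε hε2 m 1 0 0)
  · exfalso
    rw [heq] at hO
    obtain ⟨hl, -⟩ := hO'.inv_eq hO
    obtain ⟨hn1, hn2⟩ := nfun_mem_SA hε hε2 hr0' hr2'
    obtain ⟨hb1, hb2, -⟩ := capN_dN_mem hε hε2 hr2 hr3 hd0
    exact latSep hn1 hn2 hb1 hb2 hl
  · obtain ⟨m, -, hm, -⟩ := hO; exact absurd (hm.symm.trans (heq.trans hD')) (toSurg_ne_capEndN_zero hε hε2 m 1 0 0)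
  · rw [heq] at hO
    obtain ⟨hl, -, hb⟩ := hO.inv_eq hO'
    obtain ⟨-, hb2, hb3⟩ := capN_dN_mem hε hε2 hr2 hr3 hd0
    obtain ⟨-, hb2', hb3'⟩ := capN_dN_mem hε hε2 hr2' hr3' hd0'
    have hn := eq_of_circleExp_eq hl (by rw [abs_lt]; constructor <;> linarith [hε2])
    exact dN_inj hε hε2 hr2 hr3 hr2' hr3' (eq_of_capN_eq_arg_eq hε hn (arg_eq_of_circleExp_eq hb))
  · exfalso
    rw [heq] at hO
    obtain ⟨hl, hy, hb⟩ := hO.inv_eq hO'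
    obtain ⟨h4', hY0⟩ := upZero hr3' hζ' hy.symm
    rw [uN, if_pos h4'] at hl; rw [uS, if_pos h4'] at hb
    obtain ⟨hdn, hdi⟩ := d5norm hr3' h4'
    have hne : d5 ε ‖ζ'‖ (arg ζ') ≠ 0 := fun h0 ↦ by rw [h0] at hdi; simp at hdi
    obtain ⟨-, hb2, hb3⟩ := capN_dN_mem hε hε2 hr2 hr3 hd0
    obtain ⟨hc1, hc2⟩ := capN_mem hε hne
    have hn := eq_of_circleExp_eq hl (by rw [abs_lt]; constructor <;> linarith [hε2])
    have hb' : Circle.exp (arg (dN hε hε2 ζ)) = Circle.exp (arg (d5 ε ‖ζ'‖ (arg ζ'))) := by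
      rw [hb, capS, show 2 * π * (arg (d5 ε ‖ζ'‖ (arg ζ')) / (2 * π) + 1) = arg (d5 ε ‖ζ'‖ (arg ζ')) + 2 * π by field_simp,
        Circle.exp_add, Circle.exp_two_pi, mul_one]
    exact dN_ne_d5 hε hε2 hr2 hr3 hr3' h4' (eq_of_capN_eq_arg_eq hε hn (arg_eq_of_circleExp_eq hb'))
  -- ζ upper
  · obtain ⟨m, -, hm, -⟩ := hO; exact absurd (hm.symm.trans (heq.trans hD')) (toSurg_ne_capEnd_zero hε hε2 m 1 0 0)
  · exfalso
    rw [← heq] at hO'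
    obtain ⟨hl, hy, -⟩ := hO'.inv_eq hO
    obtain ⟨h4, hY0⟩ := upZero hr3 hζ hy.symm
    obtain ⟨hn1, hn2⟩ := nfun_mem_SA hε hε2 hr0' hr2'
    rw [uN, if_pos h4] at hl
    obtain ⟨hdn, hdi⟩ := d5norm hr3 h4
    have hne : d5 ε ‖ζ‖ (arg ζ) ≠ 0 := fun h0 ↦ by rw [h0] at hdi; simp at hdi
    exact latSep hn1 hn2 (capN_ge_of_norm_le hε hdn) (capN_mem hε hne).2 hl
  · obtain ⟨m, -, hm, -⟩ := hO; exact absurd (hm.symm.trans (heq.trans hD')) (toSurg_ne_capEndN_zero hε hε2 m 1 0 0)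
  · exfalso
    rw [← heq] at hO'
    obtain ⟨hl, hy, hb⟩ := hO'.inv_eq hO
    obtain ⟨h4, hY0⟩ := upZero hr3 hζ hy.symm
    rw [uN, if_pos h4] at hl; rw [uS, if_pos h4] at hb
    obtain ⟨hdn, hdi⟩ := d5norm hr3 h4
    have hne : d5 ε ‖ζ‖ (arg ζ) ≠ 0 := fun h0 ↦ by rw [h0] at hdi; simp at hdi
    obtain ⟨-, hb2, hb3⟩ := capN_dN_mem hε hε2 hr2' hr3' hd0'
    obtain ⟨hc1, hc2⟩ := capN_mem hε hne
    have hn := eq_of_circleExp_eq hl (by rw [abs_lt]; constructor <;> linarith [hε2])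
    have hb' : Circle.exp (arg (dN hε hε2 ζ')) = Circle.exp (arg (d5 ε ‖ζ‖ (arg ζ))) := by
      rw [hb, capS, show 2 * π * (arg (d5 ε ‖ζ‖ (arg ζ)) / (2 * π) + 1) = arg (d5 ε ‖ζ‖ (arg ζ)) + 2 * π by field_simp,
        Circle.exp_add, Circle.exp_two_pi, mul_one]
    exact dN_ne_d5 hε hε2 hr2' hr3' hr3 h4 (eq_of_capN_eq_arg_eq hε hn (arg_eq_of_circleExp_eq hb'))
  · -- both upper
    rw [hU, hU'] at heq
    obtain ⟨hY1, hY2, hS1, hS2, hN1, hN2⟩ := u_mem hε hε2 hr3 hζ (arg ζ)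
    obtain ⟨hY1', hY2', hS1', hS2', hN1', hN2'⟩ := u_mem hε hε2 hr3' hζ' (arg ζ')
    obtain ⟨hn, hy, hth, hs⟩ := uPt_eq_uPt hε hε2 ⟨hS1.le, hS2⟩ ⟨hS1'.le, hS2'⟩
      ⟨hN2.ne, by rw [abs_of_neg hN2]; linarith [hε2]⟩ ⟨hN2'.ne, by rw [abs_of_neg hN2']; linarith [hε2]⟩ heq
    have hθ := arg_eq_of_circleExp_eq hth
    rw [← hθ] at hs hn hS1' hS2' hN1' hN2'
    have hYY := eq_of_circleExp_eq hy (by have := ρA_pos; have : ρA = 1 / 20 := rfl; rw [abs_lt]; constructor <;> linarith)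
    have hNN := eq_of_circleExp_eq hn (by rw [abs_lt]; constructor <;> linarith [hε2])
    have hrr := upper_inj hε hε2 ⟨hr3, hζ⟩ ⟨hr3', hζ'⟩ hYY hs hNN
    rw [← norm_mul_exp_arg_mul_I ζ, ← norm_mul_exp_arg_mul_I ζ', hrr, hθ]

end Main

end FP

end Literature.Topology.FourManifolds
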